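import Mathlib.RingTheory.MvPolynomial.Symmetric.NewtonIdentities
import Mathlib.RingTheory.Polynomial.Vieta
import Mathlib.RingTheory.IsTensorProduct
import Literature.NumberTheory.Automorphic.UnitaryCoherentGaloisRep
import Literature.NumberTheory.Automorphic.ClozelAlgebraicity
import Literature.NumberTheory.Automorphic.ReciprocityGLnQlModelProofs
import Literature.NumberTheory.GaloisRepresentations.FramedRepBaseChange
import Literature.LinearAlgebra.BaseChange.EigenvaluesRationalForm
import HarnessLib

/-!
# UnitaryCoherentGaloisRep — proofs companion: what the tree can say about
# `GoldringKoskivirta2019_heckeFieldFinite`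

Topic `Literature/NumberTheory/Automorphic`; a theorems-only sibling of
`UnitaryCoherentGaloisRep.lean` (no definition, no named fact, no `sorry`).

The named fact `GoldringKoskivirta2019_heckeFieldFinite` (Goldring–Koskivirta 2019, §11.1, proof
of Thm. 3.5.5, Case [LDS], opening sentences, arXiv:1507.05032 p. 40: "By (Cor. 2.2.2), `γ_π` is a
Hecke eigenclass in `H^i(Sh_𝒦^tor ⊗ ℚ̄_p, 𝒱_η^sub)` … After replacing `𝒪_𝔭` by a finite extension,
we may assume that `γ_π` lies in `H^i(Sh_𝒦^tor, 𝒱_η^sub)`") says, in the tree's rendering for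
Mok's quasi-split `U_{K/F₀}(N)`: the predicted polynomials of arithmetic Frobenius
`arithFrobPolyOfSatake ι q_u N β` of a cuspidal `σ` with non-degenerate limits of discrete series
at infinity have, over all good places `u ∤ ℓ` and all base-change Satake parameters `β` of `σ`
there, coefficients in ONE finite extension `E` of `ℚ_ℓ` inside `ℚ̄_ℓ`.

## What is proved here

* `exists_finiteDimensional_charpoly_coeff_mem` — for every continuous
  `r : Γ_K → GL_n(ℚ̄_ℓ)` there is a finite `E/ℚ_ℓ` containing every coefficient of the
  characteristic polynomial of every `r(σ)`: `r` has a model over a finite `E`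
  (`exists_hasQlModel_holds`, the Baire-category argument of Skinner 2009 §2 / Buzzard–Gee 2014,
  proved in `ReciprocityGLnQlModelProofs.lean`), characteristic polynomials are invariant under
  the change of frame (Mathlib `Matrix.charpoly_units_conj`) and commute with `E ⊆ ℚ̄_ℓ`
  (`FramedRep.charpoly_baseChange`); `exists_finiteDimensional_frobCharpoly_coeff_mem` — hence,
  over a number field `K`, every Frobenius characteristic polynomial `P` of `r`
  (`r.HasFrobCharpolyAt u P`) has coefficients in that `E` (a prime of `ℤ̄_K` above `u` and an
  arithmetic Frobenius at it exist: `primesAbove_nonempty`,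
  `exists_isArithFrobAt_of_mem_primesAbove_holds`).
* `GoldringKoskivirta2019_heckeFieldFinite_of_galoisRep_unitary` — **the fact is a corollary of
  the crux fact** `GoldringKoskivirta2019_galoisRep_unitary` (Thm. 3.5.5 itself): the predicted
  polynomial at a good `(u, β)` is a Frobenius characteristic polynomial of its `r`, so the
  previous lemma applies.  (The same implication for the Summits-side copy of the crux is
  `Summit.…GaloisRepOfUnitaryLDS.Negative.heckeFieldFinite_of_galoisRepOfUnitaryLDS`; it is
  restated here on the Literature side, where Summits files cannot be imported.)
  `GoldringKoskivirta2019_heckeFieldFinite_regular_of_HLTT` — likewise the REGULAR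
  (discrete-series) case of the fact from the named fact
  `HarrisLanTaylorThorne2016_galoisRep_unitary_discreteSeries` ([HLTT] Cor. 1.3).
* `GoldringKoskivirta2019_heckeFieldFinite_rank_zero`, `…_of_pos_rank` — the degenerate rank
  `N = 0` (a base-change Satake parameter of `σ` on `U(0)` is empty, the predicted polynomial is
  `1`, whose coefficients lie in `ℚ_ℓ = ⊥`), and the reduction of a discharge to `0 < N`, exactly
  as `GoldringKoskivirta2019_galoisRep_unitary_rank_zero` / `…_of_pos_rank` do for the crux fact.
* `arithFrobPolyOfSatake_eq_map_symm`, `exists_finiteDimensional_coeff_arithFrobPolyOfSatake_mem`,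
  `GoldringKoskivirta2019_heckeFieldFinite_of_numberField` — the printed proof's own last step
  ("After replacing `𝒪_𝔭` by a finite extension, we may assume …"): if the COMPLEX predicted
  polynomials `∏_{b ∈ β} (X - (q_u^{(N-1)/2} b)⁻¹)` have coefficients in one number field `L ⊂ ℂ`
  (the number-field form of Cor. 2.2.2 with [Har] 1990 / Blasius–Harris–Ramakrishnan 1994, taken
  as a HYPOTHESIS), then for every `ι` their `ι⁻¹`-images have coefficients in one finite `E/ℚ_ℓ`
  (primitive element `θ` of `L/ℚ`, `E = ℚ_ℓ(ι⁻¹θ)`; Neukirch, ANT II §8), which is the fact.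
* `finiteDimensional_restrictScalars_padic`, `exists_intermediateField_padic_of_eigenvector_baseChange`,
  `coeff_arithFrobPolyOfSatake_mem_of_padicEigenvector`, `coeff_arithFrobPolyOfSatake_mem_of_padicStructure`,
  `GoldringKoskivirta2019_heckeFieldFinite_of_padicRealisation` — the SAME last step in the `ℓ`-ADIC
  form in which Goldring–Koskivirta actually take it (no number field is claimed in print):
  "`γ_π` is a Hecke eigenclass in `H^i(Sh_𝒦^tor ⊗ ℚ̄_p, 𝒱_η^sub)`" = a common eigenvector, with the
  predicted coefficients as eigenvalues, in the base change `ℚ̄_ℓ ⊗_{E₀} V` of a FINITE-dimensional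
  vector space `V = H^i(Sh_𝒦^tor, 𝒱_η^sub)[1/p]` over the finite extension `E₀ = Frac 𝒪_𝔭` of `ℚ_ℓ`
  with `E₀`-linear Hecke operators (the geometric input (A'), a HYPOTHESIS); then (B') all the
  eigenvalues lie in one intermediate field finite over `E₀`
  (`Literature.LinearAlgebra.BaseChange.exists_intermediateField_of_eigenvector_baseChange`:
  the eigencharacter of the finite-dimensional `E₀`-algebra generated by the operators has a
  finite-dimensional integral domain, i.e. a field, as image — Shimura 1971, Thm. 3.48, method),
  hence finite over `ℚ_ℓ` — "After replacing `𝒪_𝔭` by a finite extension, we may assume that `γ_π`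
  lies in `H^i(Sh_𝒦^tor, 𝒱_η^sub)`".  `esymm_mem_of_powerSum_mem`,
  `coeff_prod_X_sub_C_mem_of_powerSum_mem` (Newton's identities in characteristic `0`,
  membership form, from Mathlib `MvPolynomial.mul_esymm_eq_sum`),
  `coeff_arithFrobPolyOfSatake_mem_of_padicEigenvector_powerSum` and
  `GoldringKoskivirta2019_heckeFieldFinite_of_padicRealisation_powerSum` — the same with
  Goldring–Koskivirta's own operators `T_v^{(j)}(r)` of §2.3.2, which act by the POWER SUMS of the
  predicted Frobenius eigenvalues ("Newton's identities in characteristic `0`" of the fact's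
  docstring).
* `coeff_prod_X_sub_C_inv_mul`, `coeff_prod_X_sub_C_inv_mem`, `exists_finiteDimensional_symm_comp_mem`,
  `GoldringKoskivirta2019_heckeFieldFinite_of_heckeEigenvalueField` — the number-field form again,
  but with the hypothesis in the tree's own IDIOM for Hecke-field rationality, that of the accepted
  named fact `Clozel1990_heckeEigenvalueField` (`ClozelAlgebraicity.lean`: one number field
  `E ⊂ ℂ` containing the INTEGRAL Hecke eigenvalues `t_{u,i} = q_u^{i(N-i)/2} e_i(β) =
  heckeEigenvalueOf N u β i`, `0 ≤ i ≤ N`), here for the base-change Satake parameters `β` of a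
  cuspidal `σ` on `U_{K/F₀}(N)` with non-degenerate limits of discrete series at infinity (the
  unitary/limit-of-discrete-series analogue of Clozel's theorem: [Har] 1990 with
  Blasius–Harris–Ramakrishnan 1994, "`π_f` is defined over the number field `ℚ(π_f)`").  The
  algebra is the identity `A_k = (-1)^{N-k} q_u^{-(N-k)(N-1+k)/2} t_{u,k} / t_{u,N}` for the `k`-th
  coefficient `A_k` of `∏_{b ∈ β} (X - (q_u^{(N-1)/2} b)⁻¹)`, in which `(N-k)(N-1+k)` is EVEN: the
  half-integral powers of `q_u` of the `C`-normalisation cancel against those of the Tamagawa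
  eigenvalues place by place, so no `√q_u` enters the number field (over a general field, Vieta
  for the inverted roots and homogeneity of `e_k`).

## What is NOT here, and why (triage of the discharge, 2026-08-16)

No discharge `GoldringKoskivirta2019_heckeFieldFinite_holds`.  The printed argument is the
rational (indeed number-field) structure on the coherent cohomology of the toroidal
compactification of the unitary Shimura variety carrying `π_f` (GK Cor. 2.2.2 with Thm. 2.2.1 =
Schmid, Williams, Harris; M. Harris, *Automorphic forms and the cohomology of vector bundles on
Shimura varieties*, 1990; Blasius–Harris–Ramakrishnan, Duke Math. J. 73 (1994), for limits of
discrete series): the eigenvalue character of the spherical Hecke algebra on `γ_π` takes values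
in a number field, hence in a finite extension of `ℚ_ℓ` after `ι⁻¹`.  None of its objects —
Shimura varieties, canonical/integral models, automorphic vector bundles, coherent cohomology and
its rational structure, the comparison with `(𝔤, K)`-cohomology — is typed in Mathlib or in the
tree, and the carriers `UnitaryGroup.CuspidalAutomorphicRepData` / `HasBaseChangeSatakeAt` are
bare complex vector spaces of functions with no rational structure; an inline proof is a theory,
not a lemma (triage XL).  The fact is NOT derivable from the congruence inputs of §11.1 either
(the `ℓ`-adic approximation families of `GoldringKoskivirta2019_galoisRep_unitary_of_ladicApprox`
/ the algebra-valued limit theorem): modulo `ℓ^m` only finitely many predicted coefficients are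
visible, so no uniform bound on `[ℚ_ℓ(coefficients) : ℚ_ℓ]` follows from them — which is exactly
why Goldring–Koskivirta take the finiteness of `𝒪_𝔭` from Cor. 2.2.2 BEFORE reducing modulo
`𝔭^n`.  Hence, inside the tree, the only road to the fact is through a Galois representation
with the predicted Frobenius polynomials, i.e. through the crux fact (first bullet above); as an
INPUT to a proof of the crux (hypothesis `hE` of `…_of_ladicApprox`) it is independent literature
debt of the size of the coherent-cohomology theory; the last three sections isolate that debt in the
tree's vocabulary — in the number-field form (`ι`-free, `ℓ`-free: once on the predicted
polynomials, once on the integral Hecke eigenvalues in the idiom of `Clozel1990_heckeEigenvalueField`)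
and in the `ℓ`-adic form of the printed sentence (a finite-dimensional Hecke module over a finite
`E₀/ℚ_ℓ`) — and prove everything downstream of it.

## References

* W. Goldring, J.-S. Koskivirta, *Strata Hasse invariants, Hecke algebras and Galois
  representations*, Invent. Math. 217 (2019) (arXiv:1507.05032): Thm. 3.5.5 (p. 19), Cor. 2.2.2
  (p. 14), §11.1 (p. 40). [GoldringKoskivirta2019]
* M. Harris, *Automorphic forms and the cohomology of vector bundles on Shimura varieties*, in
  Automorphic forms, Shimura varieties, and L-functions II (Ann Arbor 1988), Perspect. Math. 11
  (1990), 41–91 (the "[Har]" of Cor. 2.2.2); D. Blasius, M. Harris, D. Ramakrishnan, *Coherent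
  cohomology, limits of discrete series, and Galois conjugation*, Duke Math. J. 73 (1994), 647–685.
* J. Neukirch, *Algebraic Number Theory*, Ch. II §8 (embeddings of a number field into `ℚ̄_p`
  land in finite extensions of `ℚ_p`). [NeukirchANT1999]
* G. Shimura, *Introduction to the arithmetic theory of automorphic functions* (1971), §3.5,
  Thm. 3.48 (the Hecke operators on a space with a rational structure generate an algebra of
  finite rank; eigenvalues in a finite extension). [Shimura1971]
* C. Skinner, *A note on the `p`-adic Galois representations attached to Hilbert modular forms*,
  Doc. Math. 14 (2009), §2; K. Buzzard, T. Gee, LMS Lecture Note Ser. 414 (2014), footnote to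
  Conj. 3.2.1 (continuous `r` is defined over a finite `E/ℚ_ℓ`). [Skinner2009] [BuzzardGeeLMS2014]
-/

noncomputable section

open scoped Polynomial NumberField MatrixGroups Matrix
open Polynomial IsDedekindDomain NumberField Field
open Literature.NumberTheory.GaloisRepresentations

namespace Literature.NumberTheory.Automorphic

/-! ## Characteristic polynomials of a continuous `r : Γ_K → GL_n(ℚ̄_ℓ)` live over a finite `E/ℚ_ℓ` -/

/-- **The characteristic polynomials of a continuous `r : Γ_K → GL_n(ℚ̄_ℓ)` have coefficients in
one finite extension of `ℚ_ℓ`.**  There is an intermediate field `ℚ_ℓ ⊆ E ⊆ ℚ̄_ℓ`, finite over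
`ℚ_ℓ`, with `(charpoly r(σ)).coeff k ∈ E` for every `σ ∈ Γ_K` and every `k`: by
`exists_hasQlModel_holds` (Baire category on the compact group `Γ_K`; Skinner 2009, §2;
Buzzard–Gee 2014, footnote to Conj. 3.2.1) `r = P · (rE ⊗_E ℚ̄_ℓ) · P⁻¹` for a model `rE` over a
finite `E`, and `charpoly (P M P⁻¹) = charpoly M` (Mathlib `Matrix.charpoly_units_conj`),
`charpoly (M.map (E ⊆ ℚ̄_ℓ)) = (charpoly M).map (E ⊆ ℚ̄_ℓ)` (`FramedRep.charpoly_baseChange`).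
[folklore] -/
theorem exists_finiteDimensional_charpoly_coeff_mem {K : Type} [Field K] {ℓ : ℕ} [Fact ℓ.Prime]
    {n : ℕ} (r : FramedGaloisRep K (PadicAlgCl ℓ) n) :
    ∃ E : IntermediateField ℚ_[ℓ] (PadicAlgCl ℓ), FiniteDimensional ℚ_[ℓ] E ∧
      ∀ (σ : absoluteGaloisGroup K) (k : ℕ), (FramedRep.charpoly r σ).coeff k ∈ E := by
  obtain ⟨E, rE, hfd, P, hP⟩ := exists_hasQlModel_holds r
  refine ⟨E, hfd, fun σ k ↦ ?_⟩
  have hconj : FramedRep.charpoly (FramedRep.conj P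
        (rE.baseChange (algebraMap E (PadicAlgCl ℓ)) continuous_subtype_val)) σ =
      FramedRep.charpoly (rE.baseChange (algebraMap E (PadicAlgCl ℓ)) continuous_subtype_val) σ := by
    simp only [FramedRep.charpoly, FramedRep.conj_apply, Units.val_mul, Matrix.coe_units_inv]
    exact Matrix.charpoly_units_conj P _
  rw [← hP, hconj, FramedRep.charpoly_baseChange, Polynomial.coeff_map]
  exact SetLike.coe_mem _

/-- **The Frobenius characteristic polynomials of a continuous `r : Γ_K → GL_n(ℚ̄_ℓ)` over a
number field have coefficients in one finite extension of `ℚ_ℓ`.**  With `E` as in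
`exists_finiteDimensional_charpoly_coeff_mem r`: whenever `r.HasFrobCharpolyAt u P` (every
arithmetic Frobenius at every prime of `ℤ̄_K` above `u` has characteristic polynomial `P`), the
coefficients of `P` lie in `E`, because a prime above `u` and an arithmetic Frobenius at it exist
(`HeightOneSpectrum.primesAbove_nonempty`,
`HeightOneSpectrum.exists_isArithFrobAt_of_mem_primesAbove_holds`).  (No unramifiedness at `u`
is needed: the predicate is read at one Frobenius.) [folklore] -/
theorem exists_finiteDimensional_frobCharpoly_coeff_mem {K : Type} [Field K] [NumberField K]
    {ℓ : ℕ} [Fact ℓ.Prime] {n : ℕ} (r : FramedGaloisRep K (PadicAlgCl ℓ) n) :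
    ∃ E : IntermediateField ℚ_[ℓ] (PadicAlgCl ℓ), FiniteDimensional ℚ_[ℓ] E ∧
      ∀ (u : HeightOneSpectrum (𝓞 K)) (P : (PadicAlgCl ℓ)[X]), r.HasFrobCharpolyAt u P →
        ∀ k : ℕ, P.coeff k ∈ E := by
  obtain ⟨E, hfd, hE⟩ := exists_finiteDimensional_charpoly_coeff_mem r
  refine ⟨E, hfd, fun u P hP k ↦ ?_⟩
  obtain ⟨𝔓, h𝔓⟩ := HeightOneSpectrum.primesAbove_nonempty u
  obtain ⟨φ, hφ⟩ := HeightOneSpectrum.exists_isArithFrobAt_of_mem_primesAbove_holds h𝔓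
  rw [← hP 𝔓 h𝔓 φ hφ]
  exact hE φ k

/-! ## The fact as a corollary of the crux fact (Thm. 3.5.5) -/

/-- **`GoldringKoskivirta2019_heckeFieldFinite` follows from
`GoldringKoskivirta2019_galoisRep_unitary`.**  Given the Galois representation `r` of the crux
fact for the datum `(F₀, K, cK, N, ℓ, ι, σ)`, take the finite `E/ℚ_ℓ` of
`exists_finiteDimensional_charpoly_coeff_mem r`; at a good place `u ∤ ℓ` with base-change Satake
parameter `β` the crux fact gives `charpoly r(φ) = arithFrobPolyOfSatake ι q_u N β` for every
arithmetic Frobenius `φ` at every prime `𝔓 ∣ u` of `ℤ̄_K`, and such `𝔓`, `φ` exist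
(`HeightOneSpectrum.primesAbove_nonempty`,
`HeightOneSpectrum.exists_isArithFrobAt_of_mem_primesAbove_holds`), so the predicted
coefficients lie in `E`.  This is NOT the printed proof of the fact (Goldring–Koskivirta 2019,
§11.1 with Cor. 2.2.2: rationality of coherent cohomology, an input used BEFORE the Galois
representation exists); it records that inside the tree the fact carries no debt beyond the crux
fact — see the module docstring for why no independent discharge is available. [folklore] -/
theorem GoldringKoskivirta2019_heckeFieldFinite_of_galoisRep_unitary
    (h : GoldringKoskivirta2019_galoisRep_unitary) : GoldringKoskivirta2019_heckeFieldFinite := by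
  intro F₀ K _ _ _ _ _ cK hF₀ hK hc hKc N ℓ _ ι hcptK σ hLDS hℓ
  obtain ⟨r, -, hr⟩ := h F₀ K cK hF₀ hK hc hKc N ℓ ι hcptK σ hLDS hℓ
  obtain ⟨E, hfd, hE⟩ := exists_finiteDimensional_frobCharpoly_coeff_mem r
  exact ⟨E, hfd, fun u β hu hu' hβ ↦ hE u _ (hr u β hu hu' hβ).2⟩

/-- **The regular (discrete-series) case of the fact rides on [HLTT] Cor. 1.3.**  For `σ'`
cuspidal on `U_{K/F₀}(N)` with REGULAR parameter at every real place (`d.IsRegular`: discrete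
series) and `ℓ ∉ Ram(G) ∪ Ram(σ')`, the conclusion of `GoldringKoskivirta2019_heckeFieldFinite`
holds for `σ'` as soon as the named fact `HarrisLanTaylorThorne2016_galoisRep_unitary_discreteSeries`
(Harris–Lan–Taylor–Thorne 2016, Cor. 1.3, the regular-weight input of Goldring–Koskivirta §11.1)
does: its Galois representation has Frobenius polynomials over one finite `E/ℚ_ℓ`
(`exists_finiteDimensional_frobCharpoly_coeff_mem`).  Same remark as for
`GoldringKoskivirta2019_heckeFieldFinite_of_galoisRep_unitary`: a corollary-of-a-fact, not the
printed (coherent-cohomology) proof. [folklore] -/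
theorem GoldringKoskivirta2019_heckeFieldFinite_regular_of_HLTT
    (h : HarrisLanTaylorThorne2016_galoisRep_unitary_discreteSeries) :
    ∀ (F₀ K : Type) [Field F₀] [NumberField F₀] [Field K] [NumberField K] [Algebra F₀ K]
      (cK : K ≃ₐ[F₀] K), IsTotallyReal F₀ → Module.finrank F₀ K = 2 → ∀ (hc : cK ≠ 1),
      IsTotallyComplex K → ∀ (N : ℕ) (ℓ : ℕ) [Fact ℓ.Prime] (ι : PadicAlgCl ℓ ≃+* ℂ)
      (hcptK : isCompact_glFiniteIntegralLevel N K)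
      (σ' : UnitaryGroup.CuspidalAutomorphicRepData F₀ K cK N hcptK),
      (∀ (w : {w : InfinitePlace K // w.IsComplex}) (hw : cK • w.1 = w.1),
        ∃ (p q : ℕ) (d : LDSDatum p q), d.IsRegular ∧
          UnitaryGroup.IsNondegenerateLimitOfDiscreteSeriesAt F₀ K cK N (StdForm.antidiagonal N)
            hcptK σ'.1 hw hc d) →
      (∀ u : HeightOneSpectrum (𝓞 K), ((ℓ : ℕ) : 𝓞 K) ∈ u.asIdeal →
        u.asIdeal.ramificationIdx ℤ = 1 ∧ UnitaryGroup.IsUnramifiedAt F₀ K cK N hcptK σ'.1 u) →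
      ∃ E : IntermediateField ℚ_[ℓ] (PadicAlgCl ℓ), FiniteDimensional ℚ_[ℓ] E ∧
        ∀ (u : HeightOneSpectrum (𝓞 K)) (β : Multiset ℂ), ((ℓ : ℕ) : 𝓞 K) ∉ u.asIdeal →
          (∀ u' : HeightOneSpectrum (𝓞 K), u'.asIdeal.under ℤ = u.asIdeal.under ℤ →
            u'.asIdeal.ramificationIdx ℤ = 1 ∧
              UnitaryGroup.IsUnramifiedAt F₀ K cK N hcptK σ'.1 u') →
          UnitaryGroup.HasBaseChangeSatakeAt F₀ K cK N hcptK σ'.1 u β →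
            ∀ k : ℕ, (arithFrobPolyOfSatake ι u.residueCard N β).coeff k ∈ E := by
  intro F₀ K _ _ _ _ _ cK hF₀ hK hc hKc N ℓ _ ι hcptK σ' hDS hℓ
  obtain ⟨r, -, hr⟩ := h F₀ K cK hF₀ hK hc hKc N ℓ ι hcptK σ' hDS hℓ
  obtain ⟨E, hfd, hE⟩ := exists_finiteDimensional_frobCharpoly_coeff_mem r
  exact ⟨E, hfd, fun u β hu hu' hβ ↦ hE u _ (hr u β hu hu' hβ).2⟩

/-! ## The degenerate rank `N = 0`, and reduction of a discharge to positive rank -/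

/-- **The case `N = 0` of `GoldringKoskivirta2019_heckeFieldFinite`** (degenerate; no hypothesis
at infinity or at `ℓ` is needed, and `E = ℚ_ℓ` serves): a base-change Satake parameter `β` of
`σ` on `U_{K/F₀}(0)` has `0` entries (`UnitaryGroup.HasBaseChangeSatakeAt.card_eq`), so the
predicted polynomial `arithFrobPolyOfSatake ι q_u 0 β` is the empty product `1`, whose
coefficients `1, 0, 0, …` lie in the bottom intermediate field `⊥ = ℚ_ℓ`, finite over `ℚ_ℓ`.
[folklore] -/
theorem GoldringKoskivirta2019_heckeFieldFinite_rank_zero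
    (F₀ K : Type) [Field F₀] [NumberField F₀] [Field K] [NumberField K] [Algebra F₀ K]
    (cK : K ≃ₐ[F₀] K) (ℓ : ℕ) [Fact ℓ.Prime] (ι : PadicAlgCl ℓ ≃+* ℂ)
    (hcptK : isCompact_glFiniteIntegralLevel 0 K)
    (σ : UnitaryGroup.CuspidalAutomorphicRepData F₀ K cK 0 hcptK) :
    ∃ E : IntermediateField ℚ_[ℓ] (PadicAlgCl ℓ), FiniteDimensional ℚ_[ℓ] E ∧
      ∀ (u : HeightOneSpectrum (𝓞 K)) (β : Multiset ℂ),
        UnitaryGroup.HasBaseChangeSatakeAt F₀ K cK 0 hcptK σ.1 u β →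
          ∀ k : ℕ, (arithFrobPolyOfSatake ι u.residueCard 0 β).coeff k ∈ E := by
  refine ⟨⊥, inferInstance, fun u β hβ k ↦ ?_⟩
  have hβ0 : β = 0 := Multiset.card_eq_zero.mp hβ.card_eq
  subst hβ0
  have h1 : arithFrobPolyOfSatake ι u.residueCard 0 (0 : Multiset ℂ) = 1 := by
    simp [arithFrobPolyOfSatake]
  rw [h1, Polynomial.coeff_one]
  split_ifs
  · exact one_mem _
  · exact zero_mem _

/-- **Reduction of a discharge to positive rank.**  `GoldringKoskivirta2019_heckeFieldFinite`
quantifies over every `N : ℕ`; its case `N = 0` is the (proved)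
`GoldringKoskivirta2019_heckeFieldFinite_rank_zero`, so the fact follows from its own restriction
to `0 < N` — the genuine content, `m = N ≥ 1` for the Kottwitz datum `B = K`, `V = K^N ≠ 0` of
Goldring–Koskivirta, Thm. 3.5.5 / §11.1.  (A `theorem` with the restricted statement as
hypothesis; no new named fact.) [folklore] -/
theorem GoldringKoskivirta2019_heckeFieldFinite_of_pos_rank
    (h : ∀ (F₀ K : Type) [Field F₀] [NumberField F₀] [Field K] [NumberField K] [Algebra F₀ K]
      (cK : K ≃ₐ[F₀] K), IsTotallyReal F₀ → Module.finrank F₀ K = 2 → ∀ (hc : cK ≠ 1),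
      IsTotallyComplex K → ∀ (N : ℕ), 0 < N → ∀ (ℓ : ℕ) [Fact ℓ.Prime] (ι : PadicAlgCl ℓ ≃+* ℂ)
      (hcptK : isCompact_glFiniteIntegralLevel N K)
      (σ : UnitaryGroup.CuspidalAutomorphicRepData F₀ K cK N hcptK),
      (∀ (w : {w : InfinitePlace K // w.IsComplex}) (hw : cK • w.1 = w.1),
        ∃ (p q : ℕ) (d : LDSDatum p q),
          UnitaryGroup.IsNondegenerateLimitOfDiscreteSeriesAt F₀ K cK N (StdForm.antidiagonal N)
            hcptK σ.1 hw hc d) →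
      (∀ u : HeightOneSpectrum (𝓞 K), ((ℓ : ℕ) : 𝓞 K) ∈ u.asIdeal →
        u.asIdeal.ramificationIdx ℤ = 1 ∧ UnitaryGroup.IsUnramifiedAt F₀ K cK N hcptK σ.1 u) →
      ∃ E : IntermediateField ℚ_[ℓ] (PadicAlgCl ℓ), FiniteDimensional ℚ_[ℓ] E ∧
        ∀ (u : HeightOneSpectrum (𝓞 K)) (β : Multiset ℂ), ((ℓ : ℕ) : 𝓞 K) ∉ u.asIdeal →
          (∀ u' : HeightOneSpectrum (𝓞 K), u'.asIdeal.under ℤ = u.asIdeal.under ℤ →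
            u'.asIdeal.ramificationIdx ℤ = 1 ∧
              UnitaryGroup.IsUnramifiedAt F₀ K cK N hcptK σ.1 u') →
          UnitaryGroup.HasBaseChangeSatakeAt F₀ K cK N hcptK σ.1 u β →
            ∀ k : ℕ, (arithFrobPolyOfSatake ι u.residueCard N β).coeff k ∈ E) :
    GoldringKoskivirta2019_heckeFieldFinite := by
  intro F₀ K _ _ _ _ _ cK hF₀ hK hc hKc N
  obtain _ | N := N
  · intro ℓ _ ι hcptK σ _ _
    obtain ⟨E, hE, hE'⟩ := GoldringKoskivirta2019_heckeFieldFinite_rank_zero F₀ K cK ℓ ι hcptK σ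
    exact ⟨E, hE, fun u β _ _ hβ ↦ hE' u β hβ⟩
  · exact h F₀ K cK hF₀ hK hc hKc (N + 1) N.succ_pos

/-! ## Goldring–Koskivirta §11.1, the step "after replacing `𝒪_𝔭` by a finite extension":
## the fact from the NUMBER-FIELD rationality of the predicted Frobenius polynomials

The printed road to `GoldringKoskivirta2019_heckeFieldFinite` (op. cit. §11.1, arXiv:1507.05032
p. 40, Case [LDS]: "By (Cor. 2.2.2), we have that `γ_π` is a Hecke eigenclass in
`H^i(Sh_𝒦^tor ⊗ ℚ̄_p, 𝒱_η^sub)` … After replacing `𝒪_𝔭` by a finite extension, we may assume that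
`γ_π` lies in `H^i(Sh_𝒦^tor, 𝒱_η^sub)`") has two steps: (A) the DEEP input — Cor. 2.2.2 (p. 14:
"Suppose `π = π_f ⊗ π(λ, 𝒞)` is a cuspidal automorphic representation of `G` … Then there is a
`G(𝔸_f)`-equivariant embedding `π_f ↪ H̄^{cd(𝒞)}(Sh(G,X), 𝒱_{-w_{0,c}λ-ρ})`", deduced from
Thm. 2.2.1 = Schmid–Williams–Harris "with Theorem 2.7, Proposition 3.2.2, and Formula 3.0.2 of
[Har]" = M. Harris, *Automorphic forms and the cohomology of vector bundles on Shimura varieties*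
(1990), whose rational structure on `H̄` makes the spherical Hecke eigensystem `θ_π` of `π` take
values in a NUMBER FIELD; Blasius–Harris–Ramakrishnan, Duke Math. J. 73 (1994) for limits of
discrete series), which through the Satake isomorphism over `ℤ[q_v^{±1}]` (§2.3.2; Cartier 1979
§IV, Mínguez 2011 Thm. 4.1 in the unitary case) says that the complex polynomials
`∏_{b ∈ β} (X - (q_u^{(N-1)/2} b)⁻¹) ∈ ℂ[X]` predicted at the good places have all their
coefficients in one number field `L ⊂ ℂ` (the half-integral powers of `q_u` cancel in the
`C`-normalisation, see the docstring of the fact); and (B) the GLUE — `ι⁻¹(L)` lies in a finite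
extension `E` of `ℚ_ℓ` inside `ℚ̄_ℓ` (`L = ℚ(θ)`, `ι⁻¹θ` is algebraic over `ℚ_ℓ`), so the predicted
`ℓ`-adic polynomials `arithFrobPolyOfSatake ι q_u N β = ι⁻¹(complex polynomial)` have coefficients
in `E`.  Step (B) is proved below in full generality
(`exists_finiteDimensional_coeff_arithFrobPolyOfSatake_mem`); step (A) — none of whose objects is
typed in Mathlib or the tree, see the module docstring — enters the last theorem as a HYPOTHESIS
(a `theorem`, no new named fact, D-0026), stated `ι`-free and `ℓ`-free exactly as the number-field
form delivers it. -/

section NumberFieldGlue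

variable {ℓ : ℕ} [Fact ℓ.Prime]

/-- `arithFrobPolyOfSatake ι q m α` is `ι⁻¹` applied coefficientwise to the COMPLEX predicted
polynomial `∏_{a ∈ α} (X - (q^{(m-1)/2} a)⁻¹) ∈ ℂ[X]` (unfolding; `Polynomial.map_multiset_prod`).
[folklore] -/
theorem arithFrobPolyOfSatake_eq_map_symm (ι : PadicAlgCl ℓ ≃+* ℂ) (q m : ℕ) (α : Multiset ℂ) :
    arithFrobPolyOfSatake ι q m α =
      ((α.map fun a ↦ X - C ((((Real.sqrt q : ℝ) : ℂ) ^ (m - 1) * a)⁻¹)).prod).map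
        (ι.symm : ℂ →+* PadicAlgCl ℓ) := by
  rw [arithFrobPolyOfSatake, Polynomial.map_multiset_prod, Multiset.map_map]
  congr 1
  refine Multiset.map_congr rfl fun a _ ↦ ?_
  simp

/-- **Step (B): number-field rationality over `ℂ` gives finiteness over `ℚ_ℓ`, uniformly.**  For
`ι : ℚ̄_ℓ ≃+* ℂ` and a number field `L ⊂ ℂ` (an intermediate field of `ℂ/ℚ`, finite over `ℚ`) there
is ONE intermediate field `ℚ_ℓ ⊆ E ⊆ ℚ̄_ℓ`, finite over `ℚ_ℓ`, such that whenever the complex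
predicted polynomial `∏_{a ∈ α} (X - (q^{(m-1)/2} a)⁻¹)` has all its coefficients in `L`, the
`ℓ`-adic one `arithFrobPolyOfSatake ι q m α` has all its coefficients in `E` — for every `q, m, α`
at once.  Proof: `E := ℚ_ℓ(ι⁻¹θ)` for a primitive element `θ` of `L/ℚ`
(Mathlib `Field.exists_primitive_element`) is finite over `ℚ_ℓ`, `ι⁻¹θ ∈ ℚ̄_ℓ` being algebraic over
`ℚ_ℓ` (`IntermediateField.adjoin.finiteDimensional`), and contains `ι⁻¹(L)` because
`(ι⁻¹)⁻¹(E) ∩ L` is an intermediate field of `L/ℚ` containing `θ`, i.e. all of `L = ℚ(θ)` — the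
"finite complete extension `τL · K_v`" of Neukirch, ANT II §8, p. 161, exactly as in the tree's
`EllipticCurves.exists_intermediateField_finiteDimensional_range_subset` (same fifteen lines,
re-proved here so as not to import the modular-forms stack into `Automorphic`); then
`arithFrobPolyOfSatake_eq_map_symm` and `Polynomial.coeff_map`.  This is Goldring–Koskivirta's
"After replacing `𝒪_𝔭` by a finite extension, we may assume …" (§11.1, p. 40).
[cite: GoldringKoskivirta2019, §11.1 (arXiv:1507.05032 p. 40), proof of Thm. 3.5.5, Case LDS]
[cite: NeukirchANT1999, Ch. II §8 (p. 161)] -/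
theorem exists_finiteDimensional_coeff_arithFrobPolyOfSatake_mem (ι : PadicAlgCl ℓ ≃+* ℂ)
    (L : IntermediateField ℚ ℂ) [FiniteDimensional ℚ L] :
    ∃ E : IntermediateField ℚ_[ℓ] (PadicAlgCl ℓ), FiniteDimensional ℚ_[ℓ] E ∧
      ∀ (q m : ℕ) (α : Multiset ℂ),
        (∀ k : ℕ,
          ((α.map fun a ↦ X - C ((((Real.sqrt q : ℝ) : ℂ) ^ (m - 1) * a)⁻¹)).prod).coeff k ∈ L) →
        ∀ k : ℕ, (arithFrobPolyOfSatake ι q m α).coeff k ∈ E := by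
  obtain ⟨θ, hθ⟩ := Field.exists_primitive_element ℚ L
  set j : L →+* PadicAlgCl ℓ := (ι.symm : ℂ →+* PadicAlgCl ℓ).comp (algebraMap L ℂ)
  have hθint : IsIntegral ℚ_[ℓ] (j θ) :=
    (Algebra.IsAlgebraic.isAlgebraic (R := ℚ_[ℓ]) (j θ)).isIntegral
  set E : IntermediateField ℚ_[ℓ] (PadicAlgCl ℓ) := IntermediateField.adjoin ℚ_[ℓ] {j θ}
  -- `j⁻¹(E)` as an intermediate field of `L/ℚ`; it contains `θ`, hence is all of `L`
  let T : IntermediateField ℚ L := (E.toSubfield.comap j).toIntermediateField fun r ↦ by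
    change j (algebraMap ℚ L r) ∈ E.toSubfield
    rw [eq_ratCast, map_ratCast]
    exact SubfieldClass.ratCast_mem E.toSubfield r
  have hT : (⊤ : IntermediateField ℚ L) ≤ T := by
    rw [← hθ, IntermediateField.adjoin_le_iff, Set.singleton_subset_iff]
    change j θ ∈ E.toSubfield
    exact IntermediateField.mem_adjoin_simple_self ℚ_[ℓ] (j θ)
  have hjE : ∀ x : L, j x ∈ E := fun x ↦ hT (IntermediateField.mem_top (x := x))
  refine ⟨E, IntermediateField.adjoin.finiteDimensional hθint, fun q m α hα k ↦ ?_⟩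
  rw [arithFrobPolyOfSatake_eq_map_symm, Polynomial.coeff_map]
  exact hjE ⟨_, hα k⟩

end NumberFieldGlue

/-- **`GoldringKoskivirta2019_heckeFieldFinite` from the number-field form of its printed input
(Goldring–Koskivirta 2019, Cor. 2.2.2 with [Har] 1990; Blasius–Harris–Ramakrishnan 1994).**
Hypothesis `h` (step (A) of the section docstring, NOT proved in the tree and NOT a named fact
here): for every datum `(F₀, K, cK, N, σ)` of the fact — `σ` cuspidal on Mok's quasi-split
`U_{K/F₀}(N)` with a non-degenerate limit of discrete series at every real place — there is a
number field `L ⊂ ℂ` containing every coefficient of the complex predicted polynomial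
`∏_{b ∈ β} (X - (q_u^{(N-1)/2} b)⁻¹)` for every finite place `u` of `K` over a rational prime `p`
with all places of `K` above `p` unramified over `ℚ` and `σ` unramified at all of them, and every
base-change Satake parameter `β` of `σ` at `u` (no prime `ℓ`, no `ι`, no hypothesis at `ℓ`: the
number-field form needs none).  Conclusion: the fact, for every `ℓ` and `ι`, with the finite
`E/ℚ_ℓ` of `exists_finiteDimensional_coeff_arithFrobPolyOfSatake_mem ι L` (step (B)); the fact's
own hypothesis at `ℓ` and its restriction to `u ∤ ℓ` are simply not used.  A `theorem` with the
printed input as hypothesis, as `GoldringKoskivirta2019_galoisRep_unitary_of_ladicApprox` is for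
the crux fact; see the module docstring for why step (A) is a theory (coherent cohomology of the
unitary Shimura variety and its rational structure) and not an inline lemma.
[cite: GoldringKoskivirta2019, §11.1 (arXiv p. 40) with Cor. 2.2.2 (p. 14) and §2.3.2] -/
theorem GoldringKoskivirta2019_heckeFieldFinite_of_numberField
    (h : ∀ (F₀ K : Type) [Field F₀] [NumberField F₀] [Field K] [NumberField K] [Algebra F₀ K]
      (cK : K ≃ₐ[F₀] K), IsTotallyReal F₀ → Module.finrank F₀ K = 2 → ∀ (hc : cK ≠ 1),
      IsTotallyComplex K → ∀ (N : ℕ) (hcptK : isCompact_glFiniteIntegralLevel N K)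
      (σ : UnitaryGroup.CuspidalAutomorphicRepData F₀ K cK N hcptK),
      (∀ (w : {w : InfinitePlace K // w.IsComplex}) (hw : cK • w.1 = w.1),
        ∃ (p q : ℕ) (d : LDSDatum p q),
          UnitaryGroup.IsNondegenerateLimitOfDiscreteSeriesAt F₀ K cK N (StdForm.antidiagonal N)
            hcptK σ.1 hw hc d) →
      ∃ L : IntermediateField ℚ ℂ, FiniteDimensional ℚ L ∧
        ∀ (u : HeightOneSpectrum (𝓞 K)) (β : Multiset ℂ),
          (∀ u' : HeightOneSpectrum (𝓞 K), u'.asIdeal.under ℤ = u.asIdeal.under ℤ →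
            u'.asIdeal.ramificationIdx ℤ = 1 ∧
              UnitaryGroup.IsUnramifiedAt F₀ K cK N hcptK σ.1 u') →
          UnitaryGroup.HasBaseChangeSatakeAt F₀ K cK N hcptK σ.1 u β →
            ∀ k : ℕ, ((β.map fun b ↦ X - C ((((Real.sqrt u.residueCard : ℝ) : ℂ) ^ (N - 1) * b)⁻¹)
              ).prod).coeff k ∈ L) :
    GoldringKoskivirta2019_heckeFieldFinite := by
  intro F₀ K _ _ _ _ _ cK hF₀ hK hc hKc N ℓ _ ι hcptK σ hLDS _
  obtain ⟨L, hL, hLβ⟩ := h F₀ K cK hF₀ hK hc hKc N hcptK σ hLDS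
  haveI := hL
  obtain ⟨E, hfd, hE⟩ := exists_finiteDimensional_coeff_arithFrobPolyOfSatake_mem ι L
  exact ⟨E, hfd, fun u β _ hu' hβ ↦ hE _ _ _ (hLβ u β hu' hβ)⟩

/-! ## The printed last step in its own `ℓ`-adic form: a finite-dimensional Hecke module over a
finite `E₀/ℚ_ℓ` realising the predicted Frobenius data gives the fact

Goldring–Koskivirta never claim a number field.  Their sentence (§11.1, arXiv:1507.05032 p. 40)
"we have that `γ_π` is a Hecke eigenclass in `H^i(Sh_𝒦^tor ⊗ ℚ̄_p, 𝒱_η^sub)`, where `i` and `η`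
are given by Theorem 2.2.1. After replacing `𝒪_𝔭` by a finite extension, we may assume that `γ_π`
lies in `H^i(Sh_𝒦^tor, 𝒱_η^sub)`" splits as follows.

(A') GEOMETRIC INPUT (Cor. 2.2.2 transported through `ι`, the integral toroidal compactification
`Sh_𝒦^tor` proper over `𝒪_𝔭` (§2.1.3), flat base change of coherent cohomology along
`𝒪_𝔭 → ℚ̄_p`, and §2.3.2: through the Satake isomorphism `ℋ_v ≅ R_fd^ss(ᴸG_v)` every class
function of a finite-dimensional algebraic representation of `ᴸG_v` — in particular
`g̃ ↦ e_k(r^∨(g̃))`, the coefficients of the characteristic polynomial of `r^∨(g̃)` for `r` the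
representation of Thm. 3.5.5 — "is" an unramified Hecke operator, acting on `γ_π` by its value on
`class_{p,ι}(π_v, ·)`): the unramified Hecke eigensystem of `σ` is realised by a common
eigenvector `x ≠ 0` of the base changes to `ℚ̄_ℓ` of `E₀`-LINEAR operators `T_{u,k}` on a
FINITE-dimensional vector space `V` (`= H^i(Sh_𝒦^tor, 𝒱_η^sub)[1/p]`) over a FINITE extension
`E₀` (`= Frac 𝒪_𝔭`) of `ℚ_ℓ`, the eigenvalue of `T_{u,k}` being the `k`-th coefficient of the
predicted polynomial `arithFrobPolyOfSatake ι q_u N β` at every good `(u, β)`.  None of its objects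
is typed in Mathlib or in the tree (module docstring); it enters below as a HYPOTHESIS.

(B') LINEAR ALGEBRA, proved: the eigenvalues of a common eigenvector in `C ⊗_L V` of `L`-linear
operators on a finite-dimensional `L`-space lie in ONE intermediate field of `C/L` finite over `L`
(`Literature.LinearAlgebra.BaseChange.exists_intermediateField_of_eigenvector_baseChange`: the
eigencharacter of the finite-dimensional `L`-subalgebra of `End_L V` they generate has as image a
finite-dimensional integral domain over `L`, a field — Shimura 1971, Thm. 3.48, method; Bourbaki,
Alg. II §8), and an intermediate field of `ℚ̄_ℓ/E₀` finite over `E₀` is finite over `ℚ_ℓ`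
(tower) — which is "After replacing `𝒪_𝔭` by a finite extension, we may assume …".

So the fact is (A') + (B'); (B') and the implication are the theorems of this section, parallel
to `Clozel1990_heckeEigenvalueField_of_rationalRealisation`
(`ClozelAlgebraicityHeckeFieldProofs.lean`, the Betti/number-field analogue for regular algebraic
`π` on `GL_n`). -/

section PadicRealisation

open scoped TensorProduct

variable {ℓ : ℕ} [Fact ℓ.Prime]

/-- Tower bookkeeping: an intermediate field of `ℚ̄_ℓ` finite over an intermediate field `E₀`
finite over `ℚ_ℓ` is finite over `ℚ_ℓ` (as the restricted-scalars intermediate field of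
`ℚ̄_ℓ/ℚ_ℓ`; same carrier, and the two `ℚ_ℓ`-module structures agree pointwise). [folklore] -/
theorem finiteDimensional_restrictScalars_padic (E₀ : IntermediateField ℚ_[ℓ] (PadicAlgCl ℓ))
    [FiniteDimensional ℚ_[ℓ] E₀] (E : IntermediateField E₀ (PadicAlgCl ℓ))
    [FiniteDimensional E₀ E] : FiniteDimensional ℚ_[ℓ] (E.restrictScalars ℚ_[ℓ]) := by
  haveI : FiniteDimensional ℚ_[ℓ] E := Module.Finite.trans E₀ E
  let f : E →ₗ[ℚ_[ℓ]] (E.restrictScalars ℚ_[ℓ]) :=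
    { toFun := fun z ↦ ⟨z, z.2⟩
      map_add' := fun _ _ ↦ rfl
      map_smul' := fun _ _ ↦ rfl }
  exact Module.Finite.of_surjective f fun z ↦ ⟨⟨z, z.2⟩, rfl⟩

/-- **(B') A common eigenvector of an `E₀`-form, `E₀/ℚ_ℓ` finite, has all its eigenvalues in one
finite extension of `ℚ_ℓ`.**  Let `ℚ_ℓ ⊆ E₀ ⊆ ℚ̄_ℓ` be finite over `ℚ_ℓ`, `V` a finite-dimensional
`E₀`-vector space with `E₀`-linear operators `T i` (`i ∈ ι`, any index set), and `x ≠ 0` in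
`ℚ̄_ℓ ⊗_{E₀} V` with `(1 ⊗ T i) x = t i • x` for all `i`.  Then there is an intermediate field
`ℚ_ℓ ⊆ E ⊆ ℚ̄_ℓ`, finite over `ℚ_ℓ`, containing every `t i`: the finite extension of `E₀` of
`Literature.LinearAlgebra.BaseChange.exists_intermediateField_of_eigenvector_baseChange`, restricted
to `ℚ_ℓ` (`finiteDimensional_restrictScalars_padic`).  This is the content of "After replacing `𝒪_𝔭`
by a finite extension, we may assume that `γ_π` lies in `H^i(Sh_𝒦^tor, 𝒱_η^sub)`"
(Goldring–Koskivirta 2019, §11.1, p. 40), `𝒪_𝔭` finite over `ℤ_p` and `H^i` finitely generated.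
[cite: Shimura1971, §3.5 (Thm. 3.48, method)]
[cite: GoldringKoskivirta2019, §11.1 (arXiv:1507.05032 p. 40), proof of Thm. 3.5.5, Case LDS] -/
theorem exists_intermediateField_padic_of_eigenvector_baseChange
    (E₀ : IntermediateField ℚ_[ℓ] (PadicAlgCl ℓ)) [FiniteDimensional ℚ_[ℓ] E₀]
    {V : Type*} [AddCommGroup V] [Module E₀ V] [FiniteDimensional E₀ V]
    {ι : Type*} (T : ι → Module.End E₀ V) (t : ι → PadicAlgCl ℓ) {x : PadicAlgCl ℓ ⊗[E₀] V}
    (hx : x ≠ 0) (h : ∀ i, (T i).baseChange (PadicAlgCl ℓ) x = t i • x) :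
    ∃ E : IntermediateField ℚ_[ℓ] (PadicAlgCl ℓ), FiniteDimensional ℚ_[ℓ] E ∧ ∀ i, t i ∈ E := by
  obtain ⟨E, hE, hmem⟩ :=
    Literature.LinearAlgebra.BaseChange.exists_intermediateField_of_eigenvector_baseChange T t hx h
  haveI := hE
  exact ⟨E.restrictScalars ℚ_[ℓ], finiteDimensional_restrictScalars_padic E₀ E,
    fun i ↦ (IntermediateField.mem_restrictScalars ℚ_[ℓ]).mpr (hmem i)⟩

/-- **Newton's identities, membership form.**  Over a field `Ω` of characteristic `0`, if every
power sum `p_j = ∑_{r ∈ R} r^j` (`j ≥ 1`) of a multiset `R` lies in a subfield `E`, then so does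
every elementary symmetric function `e_k(R)`: by Newton's identity
`k e_k = (-1)^{k+1} ∑_{a<k} (-1)^a e_a p_{k-a}` (Mathlib `MvPolynomial.mul_esymm_eq_sum`,
evaluated at an enumeration of `R`) and strong induction on `k`, dividing by `k ≠ 0`.  This is
the "(Newton's identities in characteristic `0`)" of the docstring of
`GoldringKoskivirta2019_heckeFieldFinite`: Goldring–Koskivirta's Hecke operators `T_v^{(j)}(r)`
(§2.3.2, p. 14) act by the power sums `tr(r(g̃)^j)`. [folklore] -/
theorem esymm_mem_of_powerSum_mem {Ω : Type*} [Field Ω] [CharZero Ω] (E : Subfield Ω)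
    (R : Multiset Ω) (h : ∀ j : ℕ, 0 < j → (R.map (· ^ j)).sum ∈ E) (k : ℕ) :
    R.esymm k ∈ E := by
  -- enumerate `R` by `f : Fin n → Ω`
  obtain ⟨n, f, hf⟩ : ∃ (n : ℕ) (f : Fin n → Ω), Finset.univ.val.map f = R :=
    ⟨R.toList.length, R.toList.get, by rw [Fin.univ_val_map, List.ofFn_get, Multiset.coe_toList]⟩
  subst hf
  -- evaluation of `esymm` and `psum` of `MvPolynomial (Fin n) Ω` at `f`
  have hev_e : ∀ i, MvPolynomial.aeval f (MvPolynomial.esymm (Fin n) Ω i) =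
      (Finset.univ.val.map f).esymm i := fun i ↦ MvPolynomial.aeval_esymm_eq_multiset_esymm _ _ i f
  have hev_p : ∀ j, MvPolynomial.aeval f (MvPolynomial.psum (Fin n) Ω j) =
      ((Finset.univ.val.map f).map (· ^ j)).sum := fun j ↦ by
    rw [MvPolynomial.psum, map_sum, Multiset.map_map, ← Finset.sum_map_val]
    simp
  induction k using Nat.strong_induction_on with
  | _ k ih =>
    rcases Nat.eq_zero_or_pos k with rfl | hk
    · have : (Finset.univ.val.map f).esymm 0 = 1 := by
        simp [Multiset.esymm, Multiset.powersetCard_zero_left]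
      rw [this]
      exact one_mem E
    · -- Newton's identity for `k`, evaluated at `f`
      have hN := congrArg (MvPolynomial.aeval f) (MvPolynomial.mul_esymm_eq_sum (Fin n) Ω k)
      rw [map_mul, map_natCast, hev_e, map_mul, map_sum] at hN
      -- its right-hand side lies in `E` (induction hypothesis for `e_a`, `a < k`; `h` for `p_{k-a}`)
      have hrhs : (MvPolynomial.aeval f) ((-1 : MvPolynomial (Fin n) Ω) ^ (k + 1)) *
          ∑ a ∈ (Finset.HasAntidiagonal.antidiagonal k).filter (fun a ↦ a.1 < k),
            MvPolynomial.aeval f ((-1) ^ a.1 * MvPolynomial.esymm (Fin n) Ω a.1 *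
              MvPolynomial.psum (Fin n) Ω a.2) ∈ E := by
        refine mul_mem (by rw [map_pow, map_neg, map_one]; exact pow_mem (neg_mem (one_mem E)) _)
          (sum_mem fun a ha ↦ ?_)
        rw [Finset.mem_filter, Finset.HasAntidiagonal.mem_antidiagonal] at ha
        rw [map_mul, map_mul, map_pow, map_neg, map_one, hev_e, hev_p]
        refine mul_mem (mul_mem (pow_mem (neg_mem (one_mem E)) _) (ih a.1 ha.2)) (h a.2 ?_)
        omega
      rw [← hN] at hrhs
      have hk0 : (k : Ω) ≠ 0 := Nat.cast_ne_zero.mpr hk.ne'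
      have := mul_mem (inv_mem (natCast_mem E k)) hrhs
      rwa [inv_mul_cancel_left₀ hk0] at this

/-- **Newton, for coefficients.**  Over a field of characteristic `0`, if every power sum
`∑_{r ∈ R} r^j` (`j ≥ 1`) lies in a subfield `E`, then every coefficient of `∏_{r ∈ R} (X - r)`
lies in `E` (Vieta, Mathlib `Multiset.prod_X_sub_C_coeff`: the coefficients are
`± e_{card R - k}(R)`; `esymm_mem_of_powerSum_mem`). [folklore] -/
theorem coeff_prod_X_sub_C_mem_of_powerSum_mem {Ω : Type*} [Field Ω] [CharZero Ω]
    (E : Subfield Ω) (R : Multiset Ω) (h : ∀ j : ℕ, 0 < j → (R.map (· ^ j)).sum ∈ E) (k : ℕ) :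
    ((R.map fun r ↦ X - C r).prod).coeff k ∈ E := by
  by_cases hk : k ≤ Multiset.card R
  · rw [Multiset.prod_X_sub_C_coeff R hk]
    exact mul_mem (pow_mem (neg_mem (one_mem E)) _) (esymm_mem_of_powerSum_mem E R h _)
  · rw [Polynomial.coeff_eq_zero_of_natDegree_lt]
    · exact zero_mem E
    · rw [Polynomial.natDegree_multiset_prod_X_sub_C_eq_card]
      omega

/-- `arithFrobPolyOfSatake ι q m α` is the product of `X - r` over its roots
`r = ι⁻¹((q^{(m-1)/2} a)⁻¹)`, `a ∈ α` (`roots_arithFrobPolyOfSatake`; unfolding). [folklore] -/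
theorem arithFrobPolyOfSatake_eq_prod_X_sub_C_roots (ι : PadicAlgCl ℓ ≃+* ℂ) (q m : ℕ)
    (α : Multiset ℂ) :
    arithFrobPolyOfSatake ι q m α =
      ((arithFrobPolyOfSatake ι q m α).roots.map fun r ↦ X - C r).prod := by
  rw [roots_arithFrobPolyOfSatake, Multiset.map_map]
  rfl

variable {K : Type} [Field K] [NumberField K]

/-- **The predicted coefficients served by an `ℓ`-adically rational finite-dimensional Hecke
module lie in one finite `E/ℚ_ℓ`** (the carrier form of (A') ⟹ fact).  Data: `ι : ℚ̄_ℓ ≃+* ℂ`,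
`N`, a set `S` of pairs (a finite place `u` of `K`, a multiset `β` — in the application: `u ∤ ℓ`
over a rational prime outside `Ram(G) ∪ Ram(σ)` and `β` a base-change Satake parameter of `σ` at
`u`), `ℚ_ℓ ⊆ E₀ ⊆ ℚ̄_ℓ` finite over `ℚ_ℓ`, a finite-dimensional `E₀`-space `V` with `E₀`-linear
operators `T u k`, and `x ≠ 0` in `ℚ̄_ℓ ⊗_{E₀} V` with `(1 ⊗ T u k) x = a_k(u, β) x` for every
`(u, β) ∈ S` and every `k`, where `a_k(u, β)` is the `k`-th coefficient of
`arithFrobPolyOfSatake ι q_u N β` (in print: `γ_π ∈ H^i(Sh_𝒦^tor ⊗ ℚ̄_p, 𝒱_η^sub) =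
ℚ̄_p ⊗_{𝒪_𝔭} H^i(Sh_𝒦^tor, 𝒱_η^sub)` a Hecke eigenclass, the operators being those matched by the
Satake isomorphism of §2.3.2 with the coefficient class functions of `r^∨`).  Then ONE
intermediate field `ℚ_ℓ ⊆ E ⊆ ℚ̄_ℓ` finite over `ℚ_ℓ` contains `a_k(u, β)` for all `(u, β) ∈ S` and
all `k` (`exists_intermediateField_padic_of_eigenvector_baseChange` on the index set
`{(u, β, k) | (u, β) ∈ S}`).
[cite: GoldringKoskivirta2019, §11.1 (arXiv:1507.05032 p. 40) with Cor. 2.2.2 and §2.3.2 (p. 14)] -/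
theorem coeff_arithFrobPolyOfSatake_mem_of_padicEigenvector (ι : PadicAlgCl ℓ ≃+* ℂ) (N : ℕ)
    (S : HeightOneSpectrum (𝓞 K) → Multiset ℂ → Prop)
    (E₀ : IntermediateField ℚ_[ℓ] (PadicAlgCl ℓ)) [FiniteDimensional ℚ_[ℓ] E₀]
    {V : Type*} [AddCommGroup V] [Module E₀ V] [FiniteDimensional E₀ V]
    (T : HeightOneSpectrum (𝓞 K) → ℕ → Module.End E₀ V) {x : PadicAlgCl ℓ ⊗[E₀] V} (hx : x ≠ 0)
    (h : ∀ (u : HeightOneSpectrum (𝓞 K)) (β : Multiset ℂ), S u β → ∀ k : ℕ,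
      (T u k).baseChange (PadicAlgCl ℓ) x = (arithFrobPolyOfSatake ι u.residueCard N β).coeff k • x) :
    ∃ E : IntermediateField ℚ_[ℓ] (PadicAlgCl ℓ), FiniteDimensional ℚ_[ℓ] E ∧
      ∀ (u : HeightOneSpectrum (𝓞 K)) (β : Multiset ℂ), S u β →
        ∀ k : ℕ, (arithFrobPolyOfSatake ι u.residueCard N β).coeff k ∈ E := by
  -- index the eigenvalue conditions by the triples `(u, β, k)` at which they hold
  let J := {p : HeightOneSpectrum (𝓞 K) × Multiset ℂ × ℕ // S p.1 p.2.1}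
  obtain ⟨E, hE, hmem⟩ := exists_intermediateField_padic_of_eigenvector_baseChange E₀
    (fun p : J ↦ T p.1.1 p.1.2.2)
    (fun p : J ↦ (arithFrobPolyOfSatake ι p.1.1.residueCard N p.1.2.1).coeff p.1.2.2) hx
    (fun p ↦ h p.1.1 p.1.2.1 p.2 p.1.2.2)
  exact ⟨E, hE, fun u β hS k ↦ hmem ⟨(u, β, k), hS⟩⟩

/-- **Power-sum form, with Goldring–Koskivirta's own operators `T_v^{(j)}(r)`.**  In §2.3.2
(p. 14) the Hecke operator `T_v^{(j)}(r) ∈ ℋ_v` is the one matched by the Satake isomorphism with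
the class function `g̃ ↦ tr(r(g̃)^j)` (`j ≥ 1`), so it acts on the eigenclass `γ_π` by the `j`-th
POWER SUM of the Frobenius eigenvalues; these are the operators through which the
pseudo-representations of §10–§11 are characterised.  Same data as
`coeff_arithFrobPolyOfSatake_mem_of_padicEigenvector`, except that `1 ⊗ T u j` (`j ≥ 1`) acts on
`x` by `∑_r r^j` over the roots `r` of `arithFrobPolyOfSatake ι q_u N β` (the predicted
eigenvalues of arithmetic Frobenius, `roots_arithFrobPolyOfSatake`); same conclusion: the power
sums lie in one finite `E/ℚ_ℓ` by (B'), hence — Newton's identities in characteristic `0`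
(`coeff_prod_X_sub_C_mem_of_powerSum_mem`) — so do the coefficients.
[cite: GoldringKoskivirta2019, §2.3.2 (arXiv:1507.05032 p. 14, operators T_v^{(j)}(r)) and §11.1 (p. 40)] -/
theorem coeff_arithFrobPolyOfSatake_mem_of_padicEigenvector_powerSum (ι : PadicAlgCl ℓ ≃+* ℂ)
    (N : ℕ) (S : HeightOneSpectrum (𝓞 K) → Multiset ℂ → Prop)
    (E₀ : IntermediateField ℚ_[ℓ] (PadicAlgCl ℓ)) [FiniteDimensional ℚ_[ℓ] E₀]
    {V : Type*} [AddCommGroup V] [Module E₀ V] [FiniteDimensional E₀ V]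
    (T : HeightOneSpectrum (𝓞 K) → ℕ → Module.End E₀ V) {x : PadicAlgCl ℓ ⊗[E₀] V} (hx : x ≠ 0)
    (h : ∀ (u : HeightOneSpectrum (𝓞 K)) (β : Multiset ℂ), S u β → ∀ j : ℕ, 0 < j →
      (T u j).baseChange (PadicAlgCl ℓ) x =
        ((arithFrobPolyOfSatake ι u.residueCard N β).roots.map (· ^ j)).sum • x) :
    ∃ E : IntermediateField ℚ_[ℓ] (PadicAlgCl ℓ), FiniteDimensional ℚ_[ℓ] E ∧
      ∀ (u : HeightOneSpectrum (𝓞 K)) (β : Multiset ℂ), S u β →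
        ∀ k : ℕ, (arithFrobPolyOfSatake ι u.residueCard N β).coeff k ∈ E := by
  -- (B') on the index set `{(u, β, j) | (u, β) ∈ S, 0 < j}`: the power sums lie in one finite `E`
  let J := {p : HeightOneSpectrum (𝓞 K) × Multiset ℂ × ℕ // S p.1 p.2.1 ∧ 0 < p.2.2}
  obtain ⟨E, hE, hmem⟩ := exists_intermediateField_padic_of_eigenvector_baseChange E₀
    (fun p : J ↦ T p.1.1 p.1.2.2)
    (fun p : J ↦ ((arithFrobPolyOfSatake ι p.1.1.residueCard N p.1.2.1).roots.map
      (· ^ p.1.2.2)).sum) hx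
    (fun p ↦ h p.1.1 p.1.2.1 p.2.1 p.1.2.2 p.2.2)
  refine ⟨E, hE, fun u β hS k ↦ ?_⟩
  -- Newton: coefficients of `∏ (X - r)` from the power sums of the roots
  rw [arithFrobPolyOfSatake_eq_prod_X_sub_C_roots]
  exact (IntermediateField.mem_toSubfield E _).mp
    (coeff_prod_X_sub_C_mem_of_powerSum_mem E.toSubfield _
      (fun j hj ↦ (IntermediateField.mem_toSubfield E _).mpr (hmem ⟨(u, β, j), hS, hj⟩)) k)

/-- **The same from an `E₀`-STRUCTURE on an `ℓ`-adic Hecke module** — the shape in which the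
geometry provides (A'): `H = H^i(Sh_𝒦^tor ⊗ ℚ̄_p, 𝒱_η^sub)` a `ℚ̄_ℓ`-vector space with `ℚ̄_ℓ`-linear
Hecke operators `S' u k` and the Hecke eigenclass `γ_π = x ≠ 0` of `σ` in it, and
`f : V → H`, `V = H^i(Sh_𝒦^tor, 𝒱_η^sub)[1/p]` finite-dimensional over `E₀ = Frac 𝒪_𝔭`, an
`E₀`-structure (`IsBaseChange ℚ̄_ℓ f`: flat base change of coherent cohomology along `𝒪_𝔭 → ℚ̄_p`)
preserved by the operators (`S' u k ∘ f = f ∘ T u k`: the Hecke correspondences are defined over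
`𝒪_𝔭`).  Conclusion as in `coeff_arithFrobPolyOfSatake_mem_of_padicEigenvector`, to which it reduces
by pulling `x` back along `IsBaseChange.equiv : ℚ̄_ℓ ⊗_{E₀} V ≃ H`, under which `S' u k` becomes
`(T u k).baseChange ℚ̄_ℓ`.
[cite: GoldringKoskivirta2019, §11.1 (arXiv:1507.05032 p. 40) with §2.1.3 (p. 9) and Cor. 2.2.2 (p. 14)] -/
theorem coeff_arithFrobPolyOfSatake_mem_of_padicStructure (ι : PadicAlgCl ℓ ≃+* ℂ) (N : ℕ)
    (S : HeightOneSpectrum (𝓞 K) → Multiset ℂ → Prop)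
    (E₀ : IntermediateField ℚ_[ℓ] (PadicAlgCl ℓ)) [FiniteDimensional ℚ_[ℓ] E₀]
    {V : Type*} [AddCommGroup V] [Module E₀ V] [FiniteDimensional E₀ V]
    {H : Type*} [AddCommGroup H] [Module (PadicAlgCl ℓ) H] {f : V →ₗ[E₀] H}
    (hf : IsBaseChange (PadicAlgCl ℓ) f)
    (S' : HeightOneSpectrum (𝓞 K) → ℕ → Module.End (PadicAlgCl ℓ) H)
    (T : HeightOneSpectrum (𝓞 K) → ℕ → Module.End E₀ V)
    (hST : ∀ u k (m : V), S' u k (f m) = f (T u k m)) {x : H} (hx : x ≠ 0)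
    (h : ∀ (u : HeightOneSpectrum (𝓞 K)) (β : Multiset ℂ), S u β → ∀ k : ℕ,
      S' u k x = (arithFrobPolyOfSatake ι u.residueCard N β).coeff k • x) :
    ∃ E : IntermediateField ℚ_[ℓ] (PadicAlgCl ℓ), FiniteDimensional ℚ_[ℓ] E ∧
      ∀ (u : HeightOneSpectrum (𝓞 K)) (β : Multiset ℂ), S u β →
        ∀ k : ℕ, (arithFrobPolyOfSatake ι u.residueCard N β).coeff k ∈ E := by
  -- transport along `e : ℚ̄_ℓ ⊗_{E₀} V ≃ H`; the operators `S' u k` pull back to `(T u k).baseChange`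
  set e := hf.equiv with he
  have hcomm : ∀ u k (z : PadicAlgCl ℓ ⊗[E₀] V),
      e ((T u k).baseChange (PadicAlgCl ℓ) z) = S' u k (e z) := by
    intro u k z
    induction z using TensorProduct.induction_on with
    | zero => rw [map_zero, map_zero, map_zero]
    | tmul c m =>
      rw [LinearMap.baseChange_tmul, he, IsBaseChange.equiv_tmul, IsBaseChange.equiv_tmul,
        LinearMap.map_smul_of_tower, hST]
    | add z w hz hw => rw [map_add, map_add, hz, hw, map_add, map_add]
  have hy : e.symm x ≠ 0 := fun h0 ↦ hx (by simpa using congrArg e h0)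
  refine coeff_arithFrobPolyOfSatake_mem_of_padicEigenvector ι N S E₀ T hy fun u β hS k ↦ ?_
  apply e.injective
  rw [hcomm, LinearEquiv.apply_symm_apply, h u β hS k, LinearEquiv.map_smul,
    LinearEquiv.apply_symm_apply]

/-- **`GoldringKoskivirta2019_heckeFieldFinite` from the `ℓ`-adic realisation (A') of the
eigensystem — the printed input in the printed form.**  Hypothesis `hreal` (NOT proved in the
tree and NOT a named fact here): for every datum of the fact — `σ` cuspidal on Mok's quasi-split
`U_{K/F₀}(N)` with a non-degenerate limit of discrete series at every real place, `ℓ` with every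
place of `K` above it unramified over `ℚ` and `σ` unramified there, `ι : ℚ̄_ℓ ≃+* ℂ` — there are a
finite `E₀/ℚ_ℓ` inside `ℚ̄_ℓ`, a finite-dimensional `E₀`-space `V` with `E₀`-linear operators
`T u k`, and `x ≠ 0` in `ℚ̄_ℓ ⊗_{E₀} V` on which `1 ⊗ T u k` acts by the `k`-th coefficient of
`arithFrobPolyOfSatake ι q_u N β` for every finite place `u ∤ ℓ` of `K` over a rational prime with
all places of `K` above it unramified over `ℚ` and `σ` unramified at all of them, and every
base-change Satake parameter `β` of `σ` at `u` (Goldring–Koskivirta 2019, §11.1, p. 40, first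
four sentences of the proof of Thm. 3.5.5, Case LDS, with Cor. 2.2.2, §2.1.3 and §2.3.2:
`E₀ = Frac 𝒪_𝔭`, `V = H^i(Sh_𝒦^tor, 𝒱_η^sub)[1/p]` at a `p`-hyperspecial level `𝒦` with
`π^𝒦 ≠ 0`, `x = γ_π`).  Conclusion: the fact, by (B')
(`coeff_arithFrobPolyOfSatake_mem_of_padicEigenvector`).  A `theorem` with the printed input as
hypothesis, as `GoldringKoskivirta2019_heckeFieldFinite_of_numberField` is for the number-field
form and `GoldringKoskivirta2019_galoisRep_unitary_of_ladicApprox` for the crux fact.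
[cite: GoldringKoskivirta2019, §11.1 (arXiv:1507.05032 p. 40), proof of Thm. 3.5.5, Case LDS, with Cor. 2.2.2 and §2.3.2 (p. 14)] -/
theorem GoldringKoskivirta2019_heckeFieldFinite_of_padicRealisation
    (hreal : ∀ (F₀ K : Type) [Field F₀] [NumberField F₀] [Field K] [NumberField K] [Algebra F₀ K]
      (cK : K ≃ₐ[F₀] K), IsTotallyReal F₀ → Module.finrank F₀ K = 2 → ∀ (hc : cK ≠ 1),
      IsTotallyComplex K → ∀ (N : ℕ) (ℓ : ℕ) [Fact ℓ.Prime] (ι : PadicAlgCl ℓ ≃+* ℂ)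
      (hcptK : isCompact_glFiniteIntegralLevel N K)
      (σ : UnitaryGroup.CuspidalAutomorphicRepData F₀ K cK N hcptK),
      (∀ (w : {w : InfinitePlace K // w.IsComplex}) (hw : cK • w.1 = w.1),
        ∃ (p q : ℕ) (d : LDSDatum p q),
          UnitaryGroup.IsNondegenerateLimitOfDiscreteSeriesAt F₀ K cK N (StdForm.antidiagonal N)
            hcptK σ.1 hw hc d) →
      (∀ u : HeightOneSpectrum (𝓞 K), ((ℓ : ℕ) : 𝓞 K) ∈ u.asIdeal →
        u.asIdeal.ramificationIdx ℤ = 1 ∧ UnitaryGroup.IsUnramifiedAt F₀ K cK N hcptK σ.1 u) →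
      ∃ (E₀ : IntermediateField ℚ_[ℓ] (PadicAlgCl ℓ)) (_ : FiniteDimensional ℚ_[ℓ] E₀)
        (V : Type) (_ : AddCommGroup V) (_ : Module E₀ V) (_ : FiniteDimensional E₀ V)
        (T : HeightOneSpectrum (𝓞 K) → ℕ → Module.End E₀ V) (x : PadicAlgCl ℓ ⊗[E₀] V), x ≠ 0 ∧
        ∀ (u : HeightOneSpectrum (𝓞 K)) (β : Multiset ℂ), ((ℓ : ℕ) : 𝓞 K) ∉ u.asIdeal →
          (∀ u' : HeightOneSpectrum (𝓞 K), u'.asIdeal.under ℤ = u.asIdeal.under ℤ →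
            u'.asIdeal.ramificationIdx ℤ = 1 ∧
              UnitaryGroup.IsUnramifiedAt F₀ K cK N hcptK σ.1 u') →
          UnitaryGroup.HasBaseChangeSatakeAt F₀ K cK N hcptK σ.1 u β →
            ∀ k : ℕ, (T u k).baseChange (PadicAlgCl ℓ) x =
              (arithFrobPolyOfSatake ι u.residueCard N β).coeff k • x) :
    GoldringKoskivirta2019_heckeFieldFinite := by
  intro F₀ K _ _ _ _ _ cK hF₀ hK hc hKc N ℓ _ ι hcptK σ hLDS hℓ
  obtain ⟨E₀, hE₀, V, _, _, hV, T, x, hx, h⟩ := hreal F₀ K cK hF₀ hK hc hKc N ℓ ι hcptK σ hLDS hℓ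
  haveI := hE₀
  haveI := hV
  obtain ⟨E, hE, hmem⟩ := coeff_arithFrobPolyOfSatake_mem_of_padicEigenvector ι N
    (fun u β ↦ ((ℓ : ℕ) : 𝓞 K) ∉ u.asIdeal ∧
      (∀ u' : HeightOneSpectrum (𝓞 K), u'.asIdeal.under ℤ = u.asIdeal.under ℤ →
        u'.asIdeal.ramificationIdx ℤ = 1 ∧ UnitaryGroup.IsUnramifiedAt F₀ K cK N hcptK σ.1 u') ∧
      UnitaryGroup.HasBaseChangeSatakeAt F₀ K cK N hcptK σ.1 u β)
    E₀ T hx fun u β hS k ↦ h u β hS.1 hS.2.1 hS.2.2 k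
  exact ⟨E, hE, fun u β hu hu' hβ ↦ hmem u β ⟨hu, hu', hβ⟩⟩

/-- **`GoldringKoskivirta2019_heckeFieldFinite` from the `ℓ`-adic realisation, power-sum form**
(the operators being Goldring–Koskivirta's `T_v^{(j)}(r)`, `j ≥ 1`, of §2.3.2, acting on `γ_π` by
the power sums of the predicted Frobenius eigenvalues — the roots of
`arithFrobPolyOfSatake ι q_u N β`).  As `GoldringKoskivirta2019_heckeFieldFinite_of_padicRealisation`,
through `coeff_arithFrobPolyOfSatake_mem_of_padicEigenvector_powerSum` (i.e. (B') and Newton's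
identities).
[cite: GoldringKoskivirta2019, §11.1 (arXiv:1507.05032 p. 40), proof of Thm. 3.5.5, Case LDS, with Cor. 2.2.2 and §2.3.2 (p. 14, T_v^{(j)}(r))] -/
theorem GoldringKoskivirta2019_heckeFieldFinite_of_padicRealisation_powerSum
    (hreal : ∀ (F₀ K : Type) [Field F₀] [NumberField F₀] [Field K] [NumberField K] [Algebra F₀ K]
      (cK : K ≃ₐ[F₀] K), IsTotallyReal F₀ → Module.finrank F₀ K = 2 → ∀ (hc : cK ≠ 1),
      IsTotallyComplex K → ∀ (N : ℕ) (ℓ : ℕ) [Fact ℓ.Prime] (ι : PadicAlgCl ℓ ≃+* ℂ)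
      (hcptK : isCompact_glFiniteIntegralLevel N K)
      (σ : UnitaryGroup.CuspidalAutomorphicRepData F₀ K cK N hcptK),
      (∀ (w : {w : InfinitePlace K // w.IsComplex}) (hw : cK • w.1 = w.1),
        ∃ (p q : ℕ) (d : LDSDatum p q),
          UnitaryGroup.IsNondegenerateLimitOfDiscreteSeriesAt F₀ K cK N (StdForm.antidiagonal N)
            hcptK σ.1 hw hc d) →
      (∀ u : HeightOneSpectrum (𝓞 K), ((ℓ : ℕ) : 𝓞 K) ∈ u.asIdeal →
        u.asIdeal.ramificationIdx ℤ = 1 ∧ UnitaryGroup.IsUnramifiedAt F₀ K cK N hcptK σ.1 u) →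
      ∃ (E₀ : IntermediateField ℚ_[ℓ] (PadicAlgCl ℓ)) (_ : FiniteDimensional ℚ_[ℓ] E₀)
        (V : Type) (_ : AddCommGroup V) (_ : Module E₀ V) (_ : FiniteDimensional E₀ V)
        (T : HeightOneSpectrum (𝓞 K) → ℕ → Module.End E₀ V) (x : PadicAlgCl ℓ ⊗[E₀] V), x ≠ 0 ∧
        ∀ (u : HeightOneSpectrum (𝓞 K)) (β : Multiset ℂ), ((ℓ : ℕ) : 𝓞 K) ∉ u.asIdeal →
          (∀ u' : HeightOneSpectrum (𝓞 K), u'.asIdeal.under ℤ = u.asIdeal.under ℤ →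
            u'.asIdeal.ramificationIdx ℤ = 1 ∧
              UnitaryGroup.IsUnramifiedAt F₀ K cK N hcptK σ.1 u') →
          UnitaryGroup.HasBaseChangeSatakeAt F₀ K cK N hcptK σ.1 u β →
            ∀ j : ℕ, 0 < j → (T u j).baseChange (PadicAlgCl ℓ) x =
              ((arithFrobPolyOfSatake ι u.residueCard N β).roots.map (· ^ j)).sum • x) :
    GoldringKoskivirta2019_heckeFieldFinite := by
  intro F₀ K _ _ _ _ _ cK hF₀ hK hc hKc N ℓ _ ι hcptK σ hLDS hℓ
  obtain ⟨E₀, hE₀, V, _, _, hV, T, x, hx, h⟩ := hreal F₀ K cK hF₀ hK hc hKc N ℓ ι hcptK σ hLDS hℓ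
  haveI := hE₀
  haveI := hV
  obtain ⟨E, hE, hmem⟩ := coeff_arithFrobPolyOfSatake_mem_of_padicEigenvector_powerSum ι N
    (fun u β ↦ ((ℓ : ℕ) : 𝓞 K) ∉ u.asIdeal ∧
      (∀ u' : HeightOneSpectrum (𝓞 K), u'.asIdeal.under ℤ = u.asIdeal.under ℤ →
        u'.asIdeal.ramificationIdx ℤ = 1 ∧ UnitaryGroup.IsUnramifiedAt F₀ K cK N hcptK σ.1 u') ∧
      UnitaryGroup.HasBaseChangeSatakeAt F₀ K cK N hcptK σ.1 u β)
    E₀ T hx fun u β hS j hj ↦ h u β hS.1 hS.2.1 hS.2.2 j hj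
  exact ⟨E, hE, fun u β hu hu' hβ ↦ hmem u β ⟨hu, hu', hβ⟩⟩

end PadicRealisation

/-! ## The number-field form in the tree's idiom for Hecke-field rationality: the fact from
## "the integral Hecke eigenvalues `q_u^{i(N-i)/2} e_i(β)` lie in one number field"

`GoldringKoskivirta2019_heckeFieldFinite_of_numberField` takes the number-field input on the
predicted polynomials themselves.  The tree STATES Hecke-field rationality differently — through
the integral unramified Hecke eigenvalues `t_{v,i} = q_v^{i(n-i)/2} e_i(α) = heckeEigenvalueOf n v α i`
of the double cosets `[GL_n(𝒪_v) diag(ϖ_v×i, 1×(n-i)) GL_n(𝒪_v)]` (Satake–Tamagawa), as in the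
accepted named fact `Clozel1990_heckeEigenvalueField` (`ClozelAlgebraicity.lean`; Clozel 1990,
Thm. 3.13: regular algebraic cuspidal `π` on `GL_n`).  This section proves the fact from the
hypothesis written in THAT idiom for the base-change parameters `β` of `σ` (at a split place
`u ≠ cK u` these are the Tamagawa eigenvalues of `σ_v ≅ BC(σ_v)_u` on `U(F₀,v) ≅ GL_N(K_u)`; at an
inert place `q_u^{1/2} = q_v ∈ ℤ` and `β = {β_j} ∪ {1 (N odd)} ∪ {β_j⁻¹}`, Mínguez 2011, Thm. 4.1,
so that `t_{u,i} ∈ ℚ(σ)` is again the statement that the `ℚ`-rational spherical Hecke algebra of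
`U(F₀,v)` acts on `σ_v^{K_v}` through a number field).  The only mathematics is the bookkeeping of
the half-integral powers of `q_u`: with `s = q_u^{1/2}` and `t_i = s^{i(N-i)} e_i(β)`, the `k`-th
coefficient of `∏_{b ∈ β} (X - (s^{N-1} b)⁻¹)` is `(-1)^{N-k} s^{-(N-k)(N-1+k)} t_k / t_N`, and
`(N-k)(N-1+k)` is even (`coeff_prod_X_sub_C_inv_mul`, over any field), whence membership in any
subfield containing `q_u = s²` and the `t_i` (`coeff_prod_X_sub_C_inv_mem`). -/

section HeckeEigenvalueFieldGlue

variable {F : Type*} [Field F]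

/-- `e_0(s) = 1`. [folklore] -/
private theorem esymm_zero_right' (s : Multiset F) : s.esymm 0 = 1 := by
  simp [Multiset.esymm, Multiset.powersetCard_zero_left]

/-- `e_{j+1}(a ∷ s) = e_{j+1}(s) + a e_j(s)`. [folklore] -/
private theorem esymm_cons_succ' (a : F) (s : Multiset F) (j : ℕ) :
    (a ::ₘ s).esymm (j + 1) = s.esymm (j + 1) + a * s.esymm j := by
  simp only [Multiset.esymm, Multiset.powersetCard_cons, Multiset.map_add, Multiset.sum_add,
    Multiset.map_map, Function.comp_def, Multiset.prod_cons]
  rw [← Multiset.sum_map_mul_left]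

/-- `e_j(s) = 0` for `j > #s`. [folklore] -/
private theorem esymm_eq_zero_of_card_lt' (s : Multiset F) {j : ℕ} (h : Multiset.card s < j) :
    s.esymm j = 0 := by
  simp [Multiset.esymm, Multiset.powersetCard_eq_empty _ h]

/-- `e_{#s}(s) = ∏ s`. [folklore] -/
private theorem esymm_card_eq_prod' (s : Multiset F) : s.esymm (Multiset.card s) = s.prod := by
  rw [Multiset.esymm, Multiset.powersetCard_self, Multiset.map_singleton, Multiset.sum_singleton]

/-- **Elementary symmetric functions of the inverses**: `e_j(s⁻¹) · ∏ s = e_k(s)` whenever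
`j + k = #s` and `0 ∉ s`. [folklore] -/
private theorem esymm_map_inv_mul_prod' (s : Multiset F) (hs : ∀ a ∈ s, a ≠ 0) {j k : ℕ}
    (hjk : j + k = Multiset.card s) :
    (s.map (·⁻¹)).esymm j * s.prod = s.esymm k := by
  induction s using Multiset.induction_on generalizing j k with
  | empty =>
    rw [Multiset.card_zero, Nat.add_eq_zero_iff] at hjk
    obtain ⟨rfl, rfl⟩ := hjk
    simp [esymm_zero_right']
  | cons a s ih =>
    have ha : a ≠ 0 := hs a (Multiset.mem_cons_self a s)
    have hs' : ∀ b ∈ s, b ≠ 0 := fun b hb => hs b (Multiset.mem_cons_of_mem hb)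
    rw [Multiset.card_cons] at hjk
    simp only [Multiset.map_cons, Multiset.prod_cons]
    rcases j with _ | j
    · have hk : k = Multiset.card (a ::ₘ s) := by rw [Multiset.card_cons]; omega
      rw [esymm_zero_right', one_mul, hk, esymm_card_eq_prod', Multiset.prod_cons]
    rcases k with _ | k
    · have h0 : (s.map (·⁻¹)).esymm (j + 1) = 0 :=
        esymm_eq_zero_of_card_lt' _ (by rw [Multiset.card_map]; omega)
      have h1 := ih hs' (j := j) (k := 0) (by omega)
      rw [esymm_zero_right'] at h1
      rw [esymm_cons_succ', h0, zero_add, esymm_zero_right']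
      calc a⁻¹ * (s.map (·⁻¹)).esymm j * (a * s.prod)
          = (a⁻¹ * a) * ((s.map (·⁻¹)).esymm j * s.prod) := by ring
        _ = 1 := by rw [inv_mul_cancel₀ ha, one_mul, h1]
    · have h1 := ih hs' (j := j + 1) (k := k) (by omega)
      have h2 := ih hs' (j := j) (k := k + 1) (by omega)
      rw [esymm_cons_succ', esymm_cons_succ']
      calc ((s.map (·⁻¹)).esymm (j + 1) + a⁻¹ * (s.map (·⁻¹)).esymm j) * (a * s.prod)
          = a * ((s.map (·⁻¹)).esymm (j + 1) * s.prod)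
            + (a⁻¹ * a) * ((s.map (·⁻¹)).esymm j * s.prod) := by ring
        _ = s.esymm (k + 1) + a * s.esymm k := by
          rw [h1, h2, inv_mul_cancel₀ ha, one_mul, add_comm]

/-- **The twisted reciprocal polynomial through the integral Hecke eigenvalues.**  For a multiset
`β` of `k + d + 1` units of a field and `s ≠ 0`, the `k`-th coefficient `A_k` of
`∏_{b ∈ β} (X - (s^{k+d} b)⁻¹)` satisfies
`A_k · s^{(d+1)(d+2k)} · e_{k+d+1}(β) = (-1)^{d+1} · s^{k(d+1)} e_k(β)`; with `N = k + d + 1`,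
`s = √q` and `t_i = s^{i(N-i)} e_i(β)` this reads `A_k = (-1)^{N-k} q^{-(N-k)(N-1+k)/2} t_k / t_N`
(the exponent `(N-k)(N-1+k) = (d+1)(d+2k)` is even).  Vieta for the inverted roots
(`Multiset.prod_X_sub_C_coeff`, `e_j(s⁻¹) ∏ s = e_{#s-j}(s)`) and homogeneity
(`Multiset.pow_smul_esymm`). [folklore] -/
theorem coeff_prod_X_sub_C_inv_mul (s : F) (hs : s ≠ 0) (β : Multiset F)
    (hβ : ∀ b ∈ β, b ≠ 0) (k d : ℕ) (hcard : Multiset.card β = k + d + 1) :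
    ((β.map fun b ↦ X - C ((s ^ (k + d) * b)⁻¹)).prod).coeff k *
        s ^ ((d + 1) * (d + 2 * k)) * β.esymm (k + d + 1) =
      (-1) ^ (d + 1) * (s ^ (k * (d + 1)) * β.esymm k) := by
  set c : F := s ^ (k + d) with hc
  have hc0 : c ≠ 0 := pow_ne_zero _ hs
  set δ : Multiset F := β.map (c * ·) with hδ
  have hδ0 : ∀ a ∈ δ, a ≠ 0 := by
    intro a ha
    obtain ⟨b, hb, rfl⟩ := Multiset.mem_map.1 ha
    exact mul_ne_zero hc0 (hβ b hb)
  have hδcard : Multiset.card δ = k + d + 1 := by rw [hδ, Multiset.card_map, hcard]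
  have hP : (β.map fun b ↦ X - C ((c * b)⁻¹)) = (δ.map (·⁻¹)).map fun t ↦ X - C t := by
    rw [hδ, Multiset.map_map, Multiset.map_map]
    rfl
  -- Vieta for the inverted roots
  have hV : ((β.map fun b ↦ X - C ((c * b)⁻¹)).prod).coeff k =
      (-1) ^ (d + 1) * (δ.map (·⁻¹)).esymm (d + 1) := by
    rw [hP, Multiset.prod_X_sub_C_coeff _ (by rw [Multiset.card_map, hδcard]; omega),
      Multiset.card_map, hδcard]
    congr 2 <;> omega
  -- `e_{d+1}(δ⁻¹) ∏ δ = e_k(δ)`, `e_k(δ) = c^k e_k(β)`, `∏ δ = c^{k+d+1} e_{k+d+1}(β)`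
  have hinv : (δ.map (·⁻¹)).esymm (d + 1) * δ.prod = δ.esymm k :=
    esymm_map_inv_mul_prod' δ hδ0 (by rw [hδcard]; omega)
  have hek : δ.esymm k = c ^ k * β.esymm k := (Multiset.pow_smul_esymm c k β).symm
  have hprod : δ.prod = c ^ (k + d + 1) * β.esymm (k + d + 1) := by
    rw [hδ, Multiset.prod_map_mul, Multiset.map_const', Multiset.prod_replicate, Multiset.map_id',
      ← esymm_card_eq_prod', hcard]
  have key : ((β.map fun b ↦ X - C ((c * b)⁻¹)).prod).coeff k * (c ^ (k + d + 1) *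
      β.esymm (k + d + 1)) = (-1) ^ (d + 1) * (c ^ k * β.esymm k) := by
    rw [hV, ← hprod, ← hek, ← hinv]; ring
  rw [hc] at key
  apply mul_right_cancel₀ (pow_ne_zero (k * k) hs)
  linear_combination (s ^ k) * key

/-- **Membership form.**  If `s ≠ 0`, `s² ∈ E` for a subfield `E`, `β` is a multiset of `N` units
and the "integral Hecke eigenvalues" `t_i = s^{i(N-i)} e_i(β)`, `0 ≤ i ≤ N`, lie in `E`, then every
coefficient of `∏_{b ∈ β} (X - (s^{N-1} b)⁻¹)` lies in `E`
(`A_k = ± q^{-(N-k)(N-1+k)/2} t_k / t_N` with `q = s²`, `coeff_prod_X_sub_C_inv_mul`). [folklore] -/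
theorem coeff_prod_X_sub_C_inv_mem (E : Subfield F) (s : F) (hs : s ≠ 0) (hs2 : s ^ 2 ∈ E)
    (β : Multiset F) (hβ : ∀ b ∈ β, b ≠ 0) (N : ℕ) (hcard : Multiset.card β = N)
    (ht : ∀ i ≤ N, s ^ (i * (N - i)) * β.esymm i ∈ E) (k : ℕ) :
    ((β.map fun b ↦ X - C ((s ^ (N - 1) * b)⁻¹)).prod).coeff k ∈ E := by
  have hP : (β.map fun b ↦ X - C ((s ^ (N - 1) * b)⁻¹)) =
      (β.map fun b ↦ (s ^ (N - 1) * b)⁻¹).map fun t ↦ X - C t := by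
    rw [Multiset.map_map]; rfl
  rcases Nat.lt_or_ge N k with hk | hk
  · -- beyond the degree
    rw [hP, Polynomial.coeff_eq_zero_of_natDegree_lt]
    · exact E.zero_mem
    · rw [Polynomial.natDegree_multiset_prod_X_sub_C_eq_card, Multiset.card_map, hcard]; exact hk
  rcases hk.eq_or_lt with rfl | hk'
  · -- the leading coefficient
    rw [hP, Multiset.prod_X_sub_C_coeff _ (by rw [Multiset.card_map, hcard]), Multiset.card_map,
      hcard, Nat.sub_self, esymm_zero_right', pow_zero, one_mul]
    exact E.one_mem
  -- `k < N`: write `N = k + d + 1`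
  obtain ⟨d, rfl⟩ : ∃ d, N = k + d + 1 := ⟨N - k - 1, by omega⟩
  have hNk : k + d + 1 - 1 = k + d := by omega
  rw [hNk]
  have key := coeff_prod_X_sub_C_inv_mul s hs β hβ k d hcard
  -- parity: `(d+1)(d+2k)` is even
  obtain ⟨m, hm⟩ : ∃ m, (d + 1) * (d + 2 * k) = 2 * m := by
    obtain ⟨m₀, hm₀⟩ := Nat.even_mul_succ_self d
    exact ⟨m₀ + k * (d + 1), by nlinarith [hm₀]⟩
  have heN : β.esymm (k + d + 1) ≠ 0 := by
    rw [← hcard, esymm_card_eq_prod']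
    exact Multiset.prod_ne_zero fun h ↦ hβ 0 h rfl
  have hsm : s ^ ((d + 1) * (d + 2 * k)) = (s ^ 2) ^ m := by rw [hm, pow_mul]
  have htk : s ^ (k * (d + 1)) * β.esymm k ∈ E := by
    have := ht k (by omega)
    rwa [show k + d + 1 - k = d + 1 by omega] at this
  have htN : β.esymm (k + d + 1) ∈ E := by
    have := ht (k + d + 1) le_rfl
    rwa [Nat.sub_self, mul_zero, pow_zero, one_mul] at this
  have hA : ((β.map fun b ↦ X - C ((s ^ (k + d) * b)⁻¹)).prod).coeff k =
      (-1) ^ (d + 1) * (s ^ (k * (d + 1)) * β.esymm k) *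
        ((s ^ 2) ^ m * β.esymm (k + d + 1))⁻¹ := by
    rw [← key, hsm]
    field_simp
  rw [hA]
  refine E.mul_mem (E.mul_mem (E.pow_mem (E.neg_mem E.one_mem) _) htk)
    (E.inv_mem (E.mul_mem (E.pow_mem hs2 m) htN))

variable {ℓ : ℕ} [Fact ℓ.Prime]

/-- **Step (B) for an abstract number field.**  For `ι : ℚ̄_ℓ ≃+* ℂ`, a field `L` finite over `ℚ`
and a ring homomorphism `φ : L →+* ℂ` there is ONE intermediate field `ℚ_ℓ ⊆ E ⊆ ℚ̄_ℓ`, finite over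
`ℚ_ℓ`, containing `ι⁻¹(φ(L))`: `E := ℚ_ℓ(ι⁻¹ φ θ)` for a primitive element `θ` of `L/ℚ`
(`exists_finiteDimensional_coeff_arithFrobPolyOfSatake_mem` is the case of an intermediate field
`L` of `ℂ/ℚ`; the same fifteen lines, for a `Subfield ℂ` or any abstract number field).  Neukirch,
ANT II §8 (p. 161): the composite of a number field with `ℚ_ℓ` inside `ℚ̄_ℓ` is a finite extension
of `ℚ_ℓ`. [cite: NeukirchANT1999, Ch. II §8 (p. 161)] -/
theorem exists_finiteDimensional_symm_comp_mem (ι : PadicAlgCl ℓ ≃+* ℂ) {L : Type*} [Field L]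
    [Algebra ℚ L] [FiniteDimensional ℚ L] (φ : L →+* ℂ) :
    ∃ E : IntermediateField ℚ_[ℓ] (PadicAlgCl ℓ), FiniteDimensional ℚ_[ℓ] E ∧
      ∀ x : L, ι.symm (φ x) ∈ E := by
  haveI : CharZero L := charZero_of_injective_algebraMap (algebraMap ℚ L).injective
  obtain ⟨θ, hθ⟩ := Field.exists_primitive_element ℚ L
  set j : L →+* PadicAlgCl ℓ := (ι.symm : ℂ →+* PadicAlgCl ℓ).comp φ
  have hθint : IsIntegral ℚ_[ℓ] (j θ) :=
    (Algebra.IsAlgebraic.isAlgebraic (R := ℚ_[ℓ]) (j θ)).isIntegral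
  set E : IntermediateField ℚ_[ℓ] (PadicAlgCl ℓ) := IntermediateField.adjoin ℚ_[ℓ] {j θ}
  -- `j⁻¹(E)` as an intermediate field of `L/ℚ`; it contains `θ`, hence is all of `L`
  let T : IntermediateField ℚ L := (E.toSubfield.comap j).toIntermediateField fun r ↦ by
    change j (algebraMap ℚ L r) ∈ E.toSubfield
    rw [eq_ratCast, map_ratCast]
    exact SubfieldClass.ratCast_mem E.toSubfield r
  have hT : (⊤ : IntermediateField ℚ L) ≤ T := by
    rw [← hθ, IntermediateField.adjoin_le_iff, Set.singleton_subset_iff]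
    change j θ ∈ E.toSubfield
    exact IntermediateField.mem_adjoin_simple_self ℚ_[ℓ] (j θ)
  exact ⟨E, IntermediateField.adjoin.finiteDimensional hθint,
    fun x ↦ hT (IntermediateField.mem_top (x := x))⟩

/-- **`GoldringKoskivirta2019_heckeFieldFinite` from the number-field rationality of the
unramified Hecke eigenvalues, in the tree's integral-eigenvalue idiom.**  Hypothesis `h` — NOT
proved in the tree and NOT a named fact here (D-0026) — is the unitary, limit-of-discrete-series
analogue of the accepted named fact `Clozel1990_heckeEigenvalueField` (Clozel 1990, Thm. 3.13, for
REGULAR algebraic cuspidal `π` on `GL_n`), word for word in its idiom: for every datum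
`(F₀, K, cK, N, σ)` of the fact — `σ` cuspidal on Mok's quasi-split `U_{K/F₀}(N)` with a
non-degenerate limit of discrete series at every real place — there is a number field
`E ⊂ ℂ` (`Subfield ℂ`, finite over `ℚ`) containing, for every finite place `u` of `K` over a
rational prime `p` with all places of `K` above `p` unramified over `ℚ` and `σ` unramified at all
of them, and every base-change Satake parameter `β` of `σ` at `u`
(`UnitaryGroup.HasBaseChangeSatakeAt`), the INTEGRAL Hecke eigenvalues
`t_{u,i} = q_u^{i(N-i)/2} e_i(β) = heckeEigenvalueOf N u β i`, `0 ≤ i ≤ N`, of the standard base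
change `BC(σ_v)_u` to `GL_N(K_u)` (Satake–Tamagawa: the eigenvalues of the double cosets
`[GL_N(𝒪_u) diag(ϖ_u×i, 1×(N-i)) GL_N(𝒪_u)]`; at a place `u = cK u` inert over `F₀`,
`q_u^{1/2} = q_v` is integral and `β = {β_j} ∪ {1 (N odd)} ∪ {β_j⁻¹}`, Mínguez 2011, Thm. 4.1, is
the parameter read by `UnitaryGroup.IsBaseChangeParam`).  This is what the number-field form of
the printed input delivers — `π_f ↪ H̄^{cd}(Sh(G,X), 𝒱)` (Goldring–Koskivirta, Cor. 2.2.2) with the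
rational structure on coherent cohomology of M. Harris, *Automorphic forms and the cohomology of
vector bundles on Shimura varieties* (1990), Thm. 2.7, Prop. 3.2.2, and Blasius–Harris–Ramakrishnan,
*Coherent cohomology, limits of discrete series, and Galois conjugation*, Duke Math. J. 73 (1994):
`π_f` is defined over the number field `ℚ(π_f)`, so the spherical Hecke eigencharacter of `π` at
every hyperspecial place is `ℚ(π_f)`-valued on the `ℚ`-rational double-coset operators — with no
prime `ℓ`, no `ι` and no hypothesis at `ℓ`.  Conclusion: the fact, for every `ℓ` and `ι`.
Proof: the `k`-th coefficient of the complex predicted polynomial `∏_{b ∈ β} (X - (q_u^{(N-1)/2} b)⁻¹)`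
is `(-1)^{N-k} q_u^{-(N-k)(N-1+k)/2} t_{u,k} / t_{u,N}` with `(N-k)(N-1+k)` EVEN and
`t_{u,N} = e_N(β) ≠ 0` (`coeff_prod_X_sub_C_inv_mem`: the half-integral powers of `q_u` of the
`C`-normalisation cancel against those of the Tamagawa eigenvalues, place by place), hence lies
in `E`; then step (B) (`exists_finiteDimensional_symm_comp_mem ι E.subtype`) and
`arithFrobPolyOfSatake_eq_map_symm`.  So a discharge of the fact is ONE line from a named fact of
the shape of `h` (the idiom in which the tree states Hecke-field rationality), exactly as
`GoldringKoskivirta2019_heckeFieldFinite_of_numberField` is one line from its hypothesis.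
[cite: GoldringKoskivirta2019, §11.1 (arXiv:1507.05032 p. 40) with Cor. 2.2.2 (p. 14) and §2.3.1–2.3.2]
[cite: Tamagawa1963] [cite: Minguez2011, Thm. 4.1] [cite: Clozel1990, Thm. 3.13 (the idiom of `Clozel1990_heckeEigenvalueField`)] -/
theorem GoldringKoskivirta2019_heckeFieldFinite_of_heckeEigenvalueField
    (h : ∀ (F₀ K : Type) [Field F₀] [NumberField F₀] [Field K] [NumberField K] [Algebra F₀ K]
      (cK : K ≃ₐ[F₀] K), IsTotallyReal F₀ → Module.finrank F₀ K = 2 → ∀ (hc : cK ≠ 1),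
      IsTotallyComplex K → ∀ (N : ℕ) (hcptK : isCompact_glFiniteIntegralLevel N K)
      (σ : UnitaryGroup.CuspidalAutomorphicRepData F₀ K cK N hcptK),
      (∀ (w : {w : InfinitePlace K // w.IsComplex}) (hw : cK • w.1 = w.1),
        ∃ (p q : ℕ) (d : LDSDatum p q),
          UnitaryGroup.IsNondegenerateLimitOfDiscreteSeriesAt F₀ K cK N (StdForm.antidiagonal N)
            hcptK σ.1 hw hc d) →
      ∃ E : Subfield ℂ, FiniteDimensional ℚ E ∧
        ∀ (u : HeightOneSpectrum (𝓞 K)) (β : Multiset ℂ),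
          (∀ u' : HeightOneSpectrum (𝓞 K), u'.asIdeal.under ℤ = u.asIdeal.under ℤ →
            u'.asIdeal.ramificationIdx ℤ = 1 ∧
              UnitaryGroup.IsUnramifiedAt F₀ K cK N hcptK σ.1 u') →
          UnitaryGroup.HasBaseChangeSatakeAt F₀ K cK N hcptK σ.1 u β →
            ∀ i ≤ N, heckeEigenvalueOf N u β i ∈ E) :
    GoldringKoskivirta2019_heckeFieldFinite := by
  intro F₀ K _ _ _ _ _ cK hF₀ hK hc hKc N ℓ _ ι hcptK σ hLDS _
  obtain ⟨E, hE, hEβ⟩ := h F₀ K cK hF₀ hK hc hKc N hcptK σ hLDS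
  haveI := hE
  obtain ⟨E', hfd, hE'⟩ := exists_finiteDimensional_symm_comp_mem ι E.subtype
  refine ⟨E', hfd, fun u β _ hu' hβ k ↦ ?_⟩
  -- the complex predicted polynomial at `(u, β)` has all its coefficients in `E`
  have hq : ((Real.sqrt (u.residueCard : ℝ) : ℝ) : ℂ) ≠ 0 := by
    rw [Ne, Complex.ofReal_eq_zero, Real.sqrt_eq_zero']
    exact not_le.mpr (by exact_mod_cast lt_trans zero_lt_one u.one_lt_residueCard)
  have hq2 : ((Real.sqrt (u.residueCard : ℝ) : ℝ) : ℂ) ^ 2 ∈ E := by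
    rw [← Complex.ofReal_pow, Real.sq_sqrt (Nat.cast_nonneg _), Complex.ofReal_natCast]
    exact natCast_mem E _
  have hβ0 : ∀ b ∈ β, b ≠ 0 := by
    obtain ⟨-, βf, -, -, -, hbc, rfl, -⟩ := hβ
    intro b hb
    obtain ⟨i, -, rfl⟩ := Multiset.mem_map.1 hb
    exact hbc.1 i
  have hmem := coeff_prod_X_sub_C_inv_mem E _ hq hq2 β hβ0 N hβ.card_eq
    (fun i hi ↦ hEβ u β hu' hβ i hi) k
  rw [arithFrobPolyOfSatake_eq_map_symm, Polynomial.coeff_map]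
  exact hE' ⟨_, hmem⟩

end HeckeEigenvalueFieldGlue

/-! ## The number-field route in the shape the coherent cohomology supplies it: a rational
finite-dimensional Hecke-module realisation of the eigensystem (Harris 1990; [Har] of
Goldring–Koskivirta, Cor. 2.2.2)

Goldring–Koskivirta, Cor. 2.2.2 (arXiv:1507.05032 p. 14, "Combining the above theorem
[Thm. 2.2.1, Schmid–Williams–Harris] with Theorem 2.7, Proposition 3.2.2, and Formula 3.0.2 of
[Har], one deduces"): for `π = π_f ⊗ π(λ, 𝒞)` cuspidal with `π(λ, 𝒞)` a non-degenerate limit of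
discrete series there is a `G(𝔸_f)`-equivariant embedding
`π_f ↪ H̄^{cd(𝒞)}(Sh(G,X), 𝒱_{-w_{0,c}λ-ρ})`; and M. Harris, *Automorphic forms of
`∂̄`-cohomology type as coherent cohomology classes*, J. Differential Geom. 32 (1990), 1–63
(held text `paper:doi-10-4310-jdg-1214445036`), Prop. (2.8) (p. 19): "The long exact sequence
(2.6.1) of admissible `G(𝔸_f)`-modules is naturally defined over the field of definition of `𝒱`
as a `G`-homogeneous vector bundle over `M̌`. Let `L` be this field of definition", with
(introduction, A, p. 3) "natural rational structures over the field of definition `L_σ` of `[𝒱_σ]`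
… `L_σ` is always a number field", and Thm. (5.4) with its Remark (p. 39: "This theorem has
interesting applications to eigenvalues of Hecke operators [5]", [5] = Blasius–Harris–Ramakrishnan).
At a level `K_f` the `K_f`-invariants of the admissible `H̄^q` are a finite-dimensional complex
vector space with an `L`-structure preserved by the (`ℚ`-rational, integral) unramified Hecke
operators, and the spherical line of `π_f^{K_f}` is a common eigenvector with the integral
eigenvalues `t_{u,i} = heckeEigenvalueOf N u β i` (the dictionary of
`GoldringKoskivirta2019_heckeFieldFinite_of_heckeEigenvalueField`).  The two theorems below take
exactly this — in the two shapes used for the `GL_n` analogue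
`Clozel1990_heckeEigenvalueField_of_rationalRealisation` /
`heckeEigenvalue_mem_subfield_of_rationalStructure` (`ClozelAlgebraicityHeckeFieldProofs.lean`) — as
a HYPOTHESIS (not proved in the tree, which has no Shimura varieties, automorphic bundles or
coherent cohomology; not a named fact, D-0026) and conclude the fact: the linear algebra is
`Literature.LinearAlgebra.BaseChange.exists_subfield_of_eigenvector_baseChange` (a common
eigenvector in `ℂ ⊗_L V`, `V` finite-dimensional over the number field `L`, of `L`-linear operators
has all its eigenvalues in ONE subfield of `ℂ` finite over `ℚ` — the eigencharacter of the
finite-dimensional commutative `L`-algebra the operators generate), then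
`GoldringKoskivirta2019_heckeFieldFinite_of_heckeEigenvalueField`.  With
`GoldringKoskivirta2019_heckeFieldFinite_of_padicRealisation` (the printed `𝒪_𝔭`-integral route of
§11.1) these are the two published architectures of the fact, each reduced to its geometric input. -/

section RationalRealisationGlue

open scoped TensorProduct

/-- **`GoldringKoskivirta2019_heckeFieldFinite` from a rational finite-dimensional realisation of
the unramified eigensystem** (Goldring–Koskivirta 2019, Cor. 2.2.2, with the number-field-rational
structure on `H̄^•` of [Har] = Harris 1990 (Ann Arbor), Thm. 2.7 / Prop. 3.2.2, and Harris,
J. Differential Geom. 32 (1990), Prop. (2.8)).  Hypothesis `hreal` — NOT proved in the tree and NOT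
a named fact (D-0026): for every datum `(F₀, K, cK, N, σ)` of the fact (`σ` cuspidal on Mok's
quasi-split `U_{K/F₀}(N)` with a non-degenerate limit of discrete series at every real place) there
are a subfield `L ⊆ ℂ` finite over `ℚ`, a finite-dimensional `L`-vector space `V` with `L`-linear
operators `T u i`, and a non-zero `x ∈ ℂ ⊗_L V` with `(1 ⊗ T u i) x = t_{u,i} x`,
`t_{u,i} = heckeEigenvalueOf N u β i` (`0 ≤ i ≤ N`), for every finite place `u` of `K` over a
rational prime above which every place of `K` is unramified over `ℚ` and `σ` is unramified, and
every base-change Satake parameter `β` of `σ` at `u` (`UnitaryGroup.HasBaseChangeSatakeAt`) — in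
print `V = H̄^{cd(𝒞)}(Sh_{K_f}(G,X), 𝒱)(L)`, `x` = the image of a spherical vector of `π_f^{K_f}`.
Conclusion: the fact (for every `ℓ` and `ι`).  Proof: the `t_{u,i}` lie in one subfield of `ℂ`
finite over `ℚ` (`exists_subfield_of_eigenvector_baseChange`, indexed by the triples `(u, β, i)` at
which the eigenvalue equations hold), then
`GoldringKoskivirta2019_heckeFieldFinite_of_heckeEigenvalueField`.
[cite: GoldringKoskivirta2019, Cor. 2.2.2 (arXiv:1507.05032 p. 14) and §11.1 (p. 40)]
[cite: Harris1990, Prop. (2.8) (p. 19), Thm. (5.4) and Remark (p. 39)] -/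
theorem GoldringKoskivirta2019_heckeFieldFinite_of_rationalRealisation
    (hreal : ∀ (F₀ K : Type) [Field F₀] [NumberField F₀] [Field K] [NumberField K] [Algebra F₀ K]
      (cK : K ≃ₐ[F₀] K), IsTotallyReal F₀ → Module.finrank F₀ K = 2 → ∀ (hc : cK ≠ 1),
      IsTotallyComplex K → ∀ (N : ℕ) (hcptK : isCompact_glFiniteIntegralLevel N K)
      (σ : UnitaryGroup.CuspidalAutomorphicRepData F₀ K cK N hcptK),
      (∀ (w : {w : InfinitePlace K // w.IsComplex}) (hw : cK • w.1 = w.1),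
        ∃ (p q : ℕ) (d : LDSDatum p q),
          UnitaryGroup.IsNondegenerateLimitOfDiscreteSeriesAt F₀ K cK N (StdForm.antidiagonal N)
            hcptK σ.1 hw hc d) →
      ∃ (L : IntermediateField ℚ ℂ) (_ : FiniteDimensional ℚ L) (V : Type) (_ : AddCommGroup V)
        (_ : Module L V) (_ : FiniteDimensional L V)
        (T : HeightOneSpectrum (𝓞 K) → ℕ → Module.End L V) (x : ℂ ⊗[L] V), x ≠ 0 ∧
        ∀ (u : HeightOneSpectrum (𝓞 K)) (β : Multiset ℂ),
          (∀ u' : HeightOneSpectrum (𝓞 K), u'.asIdeal.under ℤ = u.asIdeal.under ℤ →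
            u'.asIdeal.ramificationIdx ℤ = 1 ∧
              UnitaryGroup.IsUnramifiedAt F₀ K cK N hcptK σ.1 u') →
          UnitaryGroup.HasBaseChangeSatakeAt F₀ K cK N hcptK σ.1 u β →
            ∀ i ≤ N, (T u i).baseChange ℂ x = heckeEigenvalueOf N u β i • x) :
    GoldringKoskivirta2019_heckeFieldFinite := by
  refine GoldringKoskivirta2019_heckeFieldFinite_of_heckeEigenvalueField
    fun F₀ K _ _ _ _ _ cK hF₀ hK hc hKc N hcptK σ hLDS ↦ ?_
  obtain ⟨L, hL, V, _, _, hV, T, x, hx, h⟩ := hreal F₀ K cK hF₀ hK hc hKc N hcptK σ hLDS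
  haveI := hL
  haveI := hV
  -- index the eigenvalue equations by the triples `(u, β, i)` at which they hold
  let ι := {p : HeightOneSpectrum (𝓞 K) × Multiset ℂ × ℕ //
    (∀ u' : HeightOneSpectrum (𝓞 K), u'.asIdeal.under ℤ = p.1.asIdeal.under ℤ →
        u'.asIdeal.ramificationIdx ℤ = 1 ∧ UnitaryGroup.IsUnramifiedAt F₀ K cK N hcptK σ.1 u') ∧
      UnitaryGroup.HasBaseChangeSatakeAt F₀ K cK N hcptK σ.1 p.1 p.2.1 ∧ p.2.2 ≤ N}
  obtain ⟨E, hE, hmem⟩ :=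
    Literature.LinearAlgebra.BaseChange.exists_subfield_of_eigenvector_baseChange L
      (fun p : ι ↦ T p.1.1 p.1.2.2) (fun p : ι ↦ heckeEigenvalueOf N p.1.1 p.1.2.1 p.1.2.2) hx
      (fun p ↦ h p.1.1 p.1.2.1 p.2.1 p.2.2.1 p.1.2.2 p.2.2.2)
  exact ⟨E, hE, fun u β hu' hβ i hi ↦ hmem ⟨(u, β, i), hu', hβ, hi⟩⟩

/-- **The same from a rational STRUCTURE on a complex Hecke module** — the shape in which the
coherent cohomology provides it (Harris, J. Differential Geom. 32 (1990), Prop. (2.8): the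
admissible `G(𝔸_f)`-module `H̄^q([𝒱])` "is naturally defined over the field of definition of `𝒱`",
a number field `L`; Goldring–Koskivirta, Cor. 2.2.2: `π_f ↪ H̄^{cd(𝒞)}`).  Hypothesis `hreal` — NOT
proved in the tree and NOT a named fact (D-0026): for every datum `(F₀, K, cK, N, σ)` of the fact
there are a subfield `L ⊆ ℂ` finite over `ℚ`, a complex vector space `H` (the `K_f`-invariants of
`H̄^{cd(𝒞)}(Sh(G,X), 𝒱) ⊗ ℂ`) with `ℂ`-linear operators `S u i` (the integral unramified Hecke
operators), an `L`-structure `f : V → H` (`IsBaseChange ℂ f`, `V` finite-dimensional over `L`)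
preserved by them (`S u i ∘ f = f ∘ T u i` for `L`-linear `T u i`), and a non-zero `x ∈ H` (a
spherical vector of `π_f^{K_f}`) with `S u i x = t_{u,i} x`, `t_{u,i} = heckeEigenvalueOf N u β i`,
at every good `(u, β)` as in `GoldringKoskivirta2019_heckeFieldFinite_of_rationalRealisation`.
Conclusion: the fact.  Proof: pull `x` back along `IsBaseChange.equiv : ℂ ⊗_L V ≃ H`, under which
`S u i` becomes `(T u i).baseChange ℂ`, and apply the previous theorem.
[cite: GoldringKoskivirta2019, Cor. 2.2.2 (arXiv:1507.05032 p. 14) and §11.1 (p. 40)]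
[cite: Harris1990, Prop. (2.8) (p. 19)] -/
theorem GoldringKoskivirta2019_heckeFieldFinite_of_rationalStructure
    (hreal : ∀ (F₀ K : Type) [Field F₀] [NumberField F₀] [Field K] [NumberField K] [Algebra F₀ K]
      (cK : K ≃ₐ[F₀] K), IsTotallyReal F₀ → Module.finrank F₀ K = 2 → ∀ (hc : cK ≠ 1),
      IsTotallyComplex K → ∀ (N : ℕ) (hcptK : isCompact_glFiniteIntegralLevel N K)
      (σ : UnitaryGroup.CuspidalAutomorphicRepData F₀ K cK N hcptK),
      (∀ (w : {w : InfinitePlace K // w.IsComplex}) (hw : cK • w.1 = w.1),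
        ∃ (p q : ℕ) (d : LDSDatum p q),
          UnitaryGroup.IsNondegenerateLimitOfDiscreteSeriesAt F₀ K cK N (StdForm.antidiagonal N)
            hcptK σ.1 hw hc d) →
      ∃ (L : IntermediateField ℚ ℂ) (_ : FiniteDimensional ℚ L) (V : Type) (_ : AddCommGroup V)
        (_ : Module L V) (_ : FiniteDimensional L V) (H : Type) (_ : AddCommGroup H)
        (_ : Module ℂ H) (f : V →ₗ[L] H) (_ : IsBaseChange ℂ f)
        (S : HeightOneSpectrum (𝓞 K) → ℕ → Module.End ℂ H)
        (T : HeightOneSpectrum (𝓞 K) → ℕ → Module.End L V)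
        (_ : ∀ u i (m : V), S u i (f m) = f (T u i m)) (x : H), x ≠ 0 ∧
        ∀ (u : HeightOneSpectrum (𝓞 K)) (β : Multiset ℂ),
          (∀ u' : HeightOneSpectrum (𝓞 K), u'.asIdeal.under ℤ = u.asIdeal.under ℤ →
            u'.asIdeal.ramificationIdx ℤ = 1 ∧
              UnitaryGroup.IsUnramifiedAt F₀ K cK N hcptK σ.1 u') →
          UnitaryGroup.HasBaseChangeSatakeAt F₀ K cK N hcptK σ.1 u β →
            ∀ i ≤ N, S u i x = heckeEigenvalueOf N u β i • x) :
    GoldringKoskivirta2019_heckeFieldFinite := by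
  refine GoldringKoskivirta2019_heckeFieldFinite_of_rationalRealisation
    fun F₀ K _ _ _ _ _ cK hF₀ hK hc hKc N hcptK σ hLDS ↦ ?_
  obtain ⟨L, hL, V, _, _, hV, H, _, _, f, hf, S, T, hST, x, hx, h⟩ :=
    hreal F₀ K cK hF₀ hK hc hKc N hcptK σ hLDS
  haveI := hL
  haveI := hV
  -- transport along `e : ℂ ⊗_L V ≃ H`; the operators `S u i` pull back to `(T u i).baseChange ℂ`
  set e := hf.equiv with he
  have hcomm : ∀ u i (z : ℂ ⊗[L] V), e ((T u i).baseChange ℂ z) = S u i (e z) := by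
    intro u i z
    induction z using TensorProduct.induction_on with
    | zero => rw [map_zero, map_zero, map_zero]
    | tmul c m =>
      rw [LinearMap.baseChange_tmul, he, IsBaseChange.equiv_tmul, IsBaseChange.equiv_tmul,
        LinearMap.map_smul_of_tower, hST]
    | add z w hz hw => rw [map_add, map_add, hz, hw, map_add, map_add]
  have hy : e.symm x ≠ 0 := fun h0 ↦ hx (by simpa using congrArg e h0)
  refine ⟨L, hL, V, inferInstance, inferInstance, hV, T, e.symm x, hy, fun u β hu' hβ i hi ↦ ?_⟩
  apply e.injective
  rw [hcomm, LinearEquiv.apply_symm_apply, h u β hu' hβ i hi, LinearEquiv.map_smul,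
    LinearEquiv.apply_symm_apply]

end RationalRealisationGlue


end Literature.NumberTheory.Automorphic

end
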